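import Literature.Computability.Complexity.StackFFTDriverSteps
import HarnessLib

/-!
# The register file of the factoring machine above the fast multiplier

Literature / complexity toolkit, continuing `StackFFTDriverSteps.lean` / `StackFFTDriverSlots.lean`.
All remaining stack machines of the deterministic factoring algorithm after Harvey 2021 (the
product tree, Bluestein's evaluation, Algorithms 1–2, the small-factor and large-order base
searches, the main driver) run over ONE outer role type `HReg` = the multiplier's roles `g x`
plus their own registers; as for `GSlots` / `gSt`, the registers they rewrite are collected in a
record `HSlots` (with the multiplier's record `gw : GSlots` inside), `hBase h T u` is the
ambient file with these set and `hSt h T u = gSt (rGH h) (hBase h T u) u.gw` the full file, so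
that the multiplier's theorems apply with `q := rGH h`, `T := hBase h T u`.  The file is the
(mechanical) simp interface: generic pass-through lemmas for the multiplier's state function on
registers outside its roles (`gBase_of_ne`, `fSt_of_ne`, `gSt_of_ne`, `update_…_of_ne`), then
per register `hBase_X / update_hBase_X / hSt_X / update_hSt_X`, the multiplier's interface
registers seen from outside (`hSt_gBF`, `hSt_gBG`, `hSt_gRR`, `hSt_gKN` and updates), the
ambient constants (`hSt_gv`, `hSt_gCINV`), and `hSt_eq_gSt` / `gSt_hBase`.

## References

* T. Nipkow, G. Klein, *Concrete Semantics with Isabelle/HOL*, Springer 2014, §7.2 (register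
  files as functions; the frame reasoning style of `StackZnVectors.lean`). (Folklore material,
  fully proved here.)
-/

namespace Literature.Computability.Complexity

open _root_.Computability SProg

namespace Com

/-! ### Register roles of the factoring machine above the multiplier -/
/-- Register roles of the factoring machine: the multiplier's roles `g x` and the registers of the
product tree, Bluestein's evaluation, Algorithms 1–2, the small-factor / large-order searches,
the main driver, scratch, and the input/output interface. [folklore] -/
inductive HReg
  | g (x : GReg)
  | X1
  | X2
  | X3
  | X4
  | X5
  | X6
  | FL1
  | FL2
  | U1
  | U2
  | L1
  | L2
  | L3
  | L4
  | SQ1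
  | SQ2
  | SQ3
  | SQ4
  | SQ5
  | RX1
  | RX2
  | RX3
  | RX4
  | RX5
  | RX6
  | RX7
  | RX8
  | RX9
  | PTK
  | PTU
  | BLF
  | BLA
  | BLM
  | BLMU
  | BLE
  | BLPOW
  | BLC1
  | BLC2
  | BLFP
  | BLG
  | BLOUT
  | BLK
  | A1V
  | A1I
  | A1AI
  | A1G
  | A1P
  | A1C
  | A2R
  | A2M
  | A2AL
  | A2AM
  | A2C
  | A2J
  | A2A
  | A2B
  | A2JJ
  | A2T
  | A2V
  | A2S
  | A2L1
  | A2L2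
  | A2SRT
  | A2U
  | A2D
  | A2Y
  | A2P
  | A2Q
  | SFM
  | SFD
  | SFB
  | SFBMAX
  | SFL
  | SFK
  | SFDIVS
  | SFT
  | SFCAND
  | SFBETA
  | SFE
  | SFR
  | MN0
  | MNC
  | MNF
  | MNP
  | MNB
  | MNI
  | INP
  | OUTP
  deriving DecidableEq

/-- The multiplier's roles inside the machine's roles. [folklore] -/
def HReg.ιG : GReg ↪ HReg := ⟨HReg.g, fun _ _ e => HReg.g.inj e⟩

/-- `ιG` is the constructor `g`. [folklore] -/
@[simp] theorem HReg.ιG_apply (x : GReg) : HReg.ιG x = .g x := rfl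

variable {β : Type} [DecidableEq β] (h : HReg ↪ β)

/-- The multiplier's roles in the ambient index type. [folklore] -/
abbrev rGH : GReg ↪ β := HReg.ιG.trans h

omit [DecidableEq β] in
/-- Reading a multiplier role. [folklore] -/
@[simp] theorem rGH_apply (x : GReg) : rGH h x = h (.g x) := rfl

omit [DecidableEq β] in
/-- Distinct roles are distinct registers. [folklore] -/
theorem hq_ne {i j : HReg} (hij : i ≠ j) : h i ≠ h j := fun e => hij (h.injective e)

/-! ### Generic pass-through for the multiplier's state function -/

section Generic

variable {γ : Type} [DecidableEq γ] (q : GReg ↪ γ) (T : Regs γ) (w : GSlots)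

omit [DecidableEq β] in
/-- Reading a register outside the multiplier's roles through its base file. [folklore] -/
theorem gBase_of_ne {x : γ} (hx : ∀ i, q i ≠ x) : gBase q T w x = T x := by
  have hx' : ∀ i, (x = q i) ↔ False := fun i => ⟨fun e => hx i e.symm, False.elim⟩
  simp only [gBase, Function.update_apply, hx', if_false]

omit [DecidableEq β] in
/-- Reading a register outside the level-pass roles through `fSt`. [folklore] -/
theorem fSt_of_ne (r : FReg ↪ γ) (T' : Regs γ) (z : FSlots) {x : γ} (hx : ∀ i, r i ≠ x) : fSt r T' z x = T' x := by
  have hx' : ∀ i, (x = r i) ↔ False := fun i => ⟨fun e => hx i e.symm, False.elim⟩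
  simp only [fSt, Function.update_apply, hx', if_false]

omit [DecidableEq β] in
/-- Reading a register outside the multiplier's roles through its state function. [folklore] -/
theorem gSt_of_ne {x : γ} (hx : ∀ i, q i ≠ x) : gSt q T w x = T x := by
  rw [gSt_eq_fSt, fSt_of_ne _ _ _ (fun i => hx _), gBase_of_ne q T w hx]

omit [DecidableEq β] in
/-- Writing a register outside the multiplier's roles through its base file. [folklore] -/
theorem update_gBase_of_ne {x : γ} (hx : ∀ i, q i ≠ x) (u : List Bool) :
    Function.update (gBase q T w) x u = gBase q (Function.update T x u) w := by
  funext y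
  by_cases hy : y = x
  · subst hy; rw [Function.update_self, gBase_of_ne q _ w hx, Function.update_self]
  · rw [Function.update_of_ne hy]; simp only [gBase, Function.update_apply, hy, if_false]

omit [DecidableEq β] in
/-- Writing a register outside the level-pass roles through `fSt`. [folklore] -/
theorem update_fSt_of_ne (r : FReg ↪ γ) (T' : Regs γ) (z : FSlots) {x : γ} (hx : ∀ i, r i ≠ x) (u : List Bool) :
    Function.update (fSt r T' z) x u = fSt r (Function.update T' x u) z := by
  funext y
  by_cases hy : y = x
  · subst hy; rw [Function.update_self, fSt_of_ne r _ z hx, Function.update_self]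
  · rw [Function.update_of_ne hy]; simp only [fSt, Function.update_apply, hy, if_false]

omit [DecidableEq β] in
/-- Writing a register outside the multiplier's roles through its state function. [folklore] -/
theorem update_gSt_of_ne {x : γ} (hx : ∀ i, q i ≠ x) (u : List Bool) :
    Function.update (gSt q T w) x u = gSt q (Function.update T x u) w := by
  rw [gSt_eq_fSt, update_fSt_of_ne _ _ _ (fun i => hx _), update_gBase_of_ne q T w hx, ← gSt_eq_fSt]

end Generic

/-! ### The machine's variables -/

/-- The factoring machine's variables: one field per register it owns, and the multiplier's record. [folklore] -/
structure HSlots where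
  /-- register `X1` -/ (x1 : List Bool)
  /-- register `X2` -/ (x2 : List Bool)
  /-- register `X3` -/ (x3 : List Bool)
  /-- register `X4` -/ (x4 : List Bool)
  /-- register `X5` -/ (x5 : List Bool)
  /-- register `X6` -/ (x6 : List Bool)
  /-- register `FL1` -/ (fl1 : List Bool)
  /-- register `FL2` -/ (fl2 : List Bool)
  /-- register `U1` -/ (u1 : List Bool)
  /-- register `U2` -/ (u2 : List Bool)
  /-- register `L1` -/ (l1 : List Bool)
  /-- register `L2` -/ (l2 : List Bool)
  /-- register `L3` -/ (l3 : List Bool)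
  /-- register `L4` -/ (l4 : List Bool)
  /-- register `SQ1` -/ (sq1 : List Bool)
  /-- register `SQ2` -/ (sq2 : List Bool)
  /-- register `SQ3` -/ (sq3 : List Bool)
  /-- register `SQ4` -/ (sq4 : List Bool)
  /-- register `SQ5` -/ (sq5 : List Bool)
  /-- register `RX1` -/ (rx1 : List Bool)
  /-- register `RX2` -/ (rx2 : List Bool)
  /-- register `RX3` -/ (rx3 : List Bool)
  /-- register `RX4` -/ (rx4 : List Bool)
  /-- register `RX5` -/ (rx5 : List Bool)
  /-- register `RX6` -/ (rx6 : List Bool)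
  /-- register `RX7` -/ (rx7 : List Bool)
  /-- register `RX8` -/ (rx8 : List Bool)
  /-- register `RX9` -/ (rx9 : List Bool)
  /-- register `PTK` -/ (ptk : List Bool)
  /-- register `PTU` -/ (ptu : List Bool)
  /-- register `BLF` -/ (blf : List Bool)
  /-- register `BLA` -/ (bla : List Bool)
  /-- register `BLM` -/ (blm : List Bool)
  /-- register `BLMU` -/ (blmu : List Bool)
  /-- register `BLE` -/ (ble : List Bool)
  /-- register `BLPOW` -/ (blpow : List Bool)
  /-- register `BLC1` -/ (blc1 : List Bool)
  /-- register `BLC2` -/ (blc2 : List Bool)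
  /-- register `BLFP` -/ (blfp : List Bool)
  /-- register `BLG` -/ (blg : List Bool)
  /-- register `BLOUT` -/ (blout : List Bool)
  /-- register `BLK` -/ (blk : List Bool)
  /-- register `A1V` -/ (a1v : List Bool)
  /-- register `A1I` -/ (a1i : List Bool)
  /-- register `A1AI` -/ (a1ai : List Bool)
  /-- register `A1G` -/ (a1g : List Bool)
  /-- register `A1P` -/ (a1p : List Bool)
  /-- register `A1C` -/ (a1c : List Bool)
  /-- register `A2R` -/ (a2r : List Bool)
  /-- register `A2M` -/ (a2m : List Bool)
  /-- register `A2AL` -/ (a2al : List Bool)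
  /-- register `A2AM` -/ (a2am : List Bool)
  /-- register `A2C` -/ (a2c : List Bool)
  /-- register `A2J` -/ (a2j : List Bool)
  /-- register `A2A` -/ (a2a : List Bool)
  /-- register `A2B` -/ (a2b : List Bool)
  /-- register `A2JJ` -/ (a2jj : List Bool)
  /-- register `A2T` -/ (a2t : List Bool)
  /-- register `A2V` -/ (a2v : List Bool)
  /-- register `A2S` -/ (a2s : List Bool)
  /-- register `A2L1` -/ (a2l1 : List Bool)
  /-- register `A2L2` -/ (a2l2 : List Bool)
  /-- register `A2SRT` -/ (a2srt : List Bool)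
  /-- register `A2U` -/ (a2u : List Bool)
  /-- register `A2D` -/ (a2d : List Bool)
  /-- register `A2Y` -/ (a2y : List Bool)
  /-- register `A2P` -/ (a2p : List Bool)
  /-- register `A2Q` -/ (a2q : List Bool)
  /-- register `SFM` -/ (sfm : List Bool)
  /-- register `SFD` -/ (sfd : List Bool)
  /-- register `SFB` -/ (sfb : List Bool)
  /-- register `SFBMAX` -/ (sfbmax : List Bool)
  /-- register `SFL` -/ (sfl : List Bool)
  /-- register `SFK` -/ (sfk : List Bool)
  /-- register `SFDIVS` -/ (sfdivs : List Bool)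
  /-- register `SFT` -/ (sft : List Bool)
  /-- register `SFCAND` -/ (sfcand : List Bool)
  /-- register `SFBETA` -/ (sfbeta : List Bool)
  /-- register `SFE` -/ (sfe : List Bool)
  /-- register `SFR` -/ (sfr : List Bool)
  /-- register `MN0` -/ (mn0 : List Bool)
  /-- register `MNC` -/ (mnc : List Bool)
  /-- register `MNF` -/ (mnf : List Bool)
  /-- register `MNP` -/ (mnp : List Bool)
  /-- register `MNB` -/ (mnb : List Bool)
  /-- register `MNI` -/ (mni : List Bool)
  /-- register `INP` -/ (inp : List Bool)
  /-- register `OUTP` -/ (outp : List Bool)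
  /-- the multiplier's variables -/ (gw : GSlots)

/-- The base file seen by the multiplier: the ambient file with the machine's variables set. [folklore] -/
def hBase (T : Regs β) (u : HSlots) : Regs β :=
  Function.update (Function.update (Function.update (Function.update (Function.update (Function.update (Function.update (Function.update (Function.update (Function.update (Function.update (Function.update (Function.update (Function.update (Function.update (Function.update (Function.update (Function.update (Function.update (Function.update (Function.update (Function.update (Function.update (Function.update (Function.update (Function.update (Function.update (Function.update (Function.update (Function.update (Function.update (Function.update (Function.update (Function.update (Function.update (Function.update (Function.update (Function.update (Function.update (Function.update (Function.update (Function.update (Function.update (Function.update (Function.update (Function.update (Function.update (Function.update (Function.update (Function.update (Function.update (Function.update (Function.update (Function.update (Function.update (Function.update (Function.update (Function.update (Function.update (Function.update (Function.update (Function.update (Function.update (Function.update (Function.update (Function.update (Function.update (Function.update (Function.update (Function.update (Function.update (Function.update (Function.update (Function.update (Function.update (Function.update (Function.update (Function.update (Function.update (Function.update (Function.update (Function.update (Function.update (Function.update (Function.update (Function.update (Function.update (Function.update (T) (h .X1) u.x1) (h .X2) u.x2) (h .X3) u.x3) (h .X4) u.x4) (h .X5) u.x5) (h .X6) u.x6)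 (h .FL1) u.fl1) (h .FL2) u.fl2) (h .U1) u.u1) (h .U2) u.u2) (h .L1) u.l1) (h .L2) u.l2) (h .L3) u.l3) (h .L4) u.l4) (h .SQ1) u.sq1) (h .SQ2) u.sq2) (h .SQ3) u.sq3) (h .SQ4) u.sq4) (h .SQ5) u.sq5) (h .RX1) u.rx1) (h .RX2) u.rx2) (h .RX3) u.rx3) (h .RX4) u.rx4) (h .RX5) u.rx5) (h .RX6) u.rx6) (h .RX7) u.rx7) (h .RX8) u.rx8) (h .RX9) u.rx9) (h .PTK) u.ptk) (h .PTU) u.ptu) (h .BLF) u.blf) (h .BLA) u.bla) (h .BLM) u.blm) (h .BLMU) u.blmu) (h .BLE) u.ble) (h .BLPOW) u.blpow) (h .BLC1) u.blc1) (h .BLC2) u.blc2) (h .BLFP) u.blfp) (h .BLG) u.blg) (h .BLOUT) u.blout) (h .BLK) u.blk) (h .A1V) u.a1v) (h .A1I) u.a1i) (h .A1AI) u.a1ai) (h .A1G) u.a1g) (h .A1P) u.a1p) (h .A1C) u.a1c) (h .A2R) u.a2r) (h .A2M) u.a2m) (h .A2AL) u.a2al) (h .A2AM) u.a2am) (h .A2C)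 u.a2c) (h .A2J) u.a2j) (h .A2A) u.a2a) (h .A2B) u.a2b) (h .A2JJ) u.a2jj) (h .A2T) u.a2t) (h .A2V) u.a2v) (h .A2S) u.a2s) (h .A2L1) u.a2l1) (h .A2L2) u.a2l2) (h .A2SRT) u.a2srt) (h .A2U) u.a2u) (h .A2D) u.a2d) (h .A2Y) u.a2y) (h .A2P) u.a2p) (h .A2Q) u.a2q) (h .SFM) u.sfm) (h .SFD) u.sfd) (h .SFB) u.sfb) (h .SFBMAX) u.sfbmax) (h .SFL) u.sfl) (h .SFK) u.sfk) (h .SFDIVS) u.sfdivs) (h .SFT) u.sft) (h .SFCAND) u.sfcand) (h .SFBETA) u.sfbeta) (h .SFE) u.sfe) (h .SFR) u.sfr) (h .MN0) u.mn0) (h .MNC) u.mnc) (h .MNF) u.mnf) (h .MNP) u.mnp) (h .MNB) u.mnb) (h .MNI) u.mni) (h .INP) u.inp) (h .OUTP) u.outp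

/-- The full register file of a machine state. [folklore] -/
def hSt (T : Regs β) (u : HSlots) : Regs β := gSt (rGH h) (hBase h T u) u.gw

section HStLemmas

variable (T : Regs β) (u : HSlots) (v : List Bool)

/-- Reading `X1` of the base. [folklore] -/
@[simp] theorem hBase_X1 : hBase h T u (h .X1) = u.x1 := by
  simp [hBase, hq_ne h]
/-- Reading `X2` of the base. [folklore] -/
@[simp] theorem hBase_X2 : hBase h T u (h .X2) = u.x2 := by
  simp [hBase, hq_ne h]
/-- Reading `X3` of the base. [folklore] -/
@[simp] theorem hBase_X3 : hBase h T u (h .X3) = u.x3 := by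
  simp [hBase, hq_ne h]
/-- Reading `X4` of the base. [folklore] -/
@[simp] theorem hBase_X4 : hBase h T u (h .X4) = u.x4 := by
  simp [hBase, hq_ne h]
/-- Reading `X5` of the base. [folklore] -/
@[simp] theorem hBase_X5 : hBase h T u (h .X5) = u.x5 := by
  simp [hBase, hq_ne h]
/-- Reading `X6` of the base. [folklore] -/
@[simp] theorem hBase_X6 : hBase h T u (h .X6) = u.x6 := by
  simp [hBase, hq_ne h]
/-- Reading `FL1` of the base. [folklore] -/
@[simp] theorem hBase_FL1 : hBase h T u (h .FL1) = u.fl1 := by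
  simp [hBase, hq_ne h]
/-- Reading `FL2` of the base. [folklore] -/
@[simp] theorem hBase_FL2 : hBase h T u (h .FL2) = u.fl2 := by
  simp [hBase, hq_ne h]
/-- Reading `U1` of the base. [folklore] -/
@[simp] theorem hBase_U1 : hBase h T u (h .U1) = u.u1 := by
  simp [hBase, hq_ne h]
/-- Reading `U2` of the base. [folklore] -/
@[simp] theorem hBase_U2 : hBase h T u (h .U2) = u.u2 := by
  simp [hBase, hq_ne h]
/-- Reading `L1` of the base. [folklore] -/
@[simp] theorem hBase_L1 : hBase h T u (h .L1) = u.l1 := by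
  simp [hBase, hq_ne h]
/-- Reading `L2` of the base. [folklore] -/
@[simp] theorem hBase_L2 : hBase h T u (h .L2) = u.l2 := by
  simp [hBase, hq_ne h]
/-- Reading `L3` of the base. [folklore] -/
@[simp] theorem hBase_L3 : hBase h T u (h .L3) = u.l3 := by
  simp [hBase, hq_ne h]
/-- Reading `L4` of the base. [folklore] -/
@[simp] theorem hBase_L4 : hBase h T u (h .L4) = u.l4 := by
  simp [hBase, hq_ne h]
/-- Reading `SQ1` of the base. [folklore] -/
@[simp] theorem hBase_SQ1 : hBase h T u (h .SQ1) = u.sq1 := by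
  simp [hBase, hq_ne h]
/-- Reading `SQ2` of the base. [folklore] -/
@[simp] theorem hBase_SQ2 : hBase h T u (h .SQ2) = u.sq2 := by
  simp [hBase, hq_ne h]
/-- Reading `SQ3` of the base. [folklore] -/
@[simp] theorem hBase_SQ3 : hBase h T u (h .SQ3) = u.sq3 := by
  simp [hBase, hq_ne h]
/-- Reading `SQ4` of the base. [folklore] -/
@[simp] theorem hBase_SQ4 : hBase h T u (h .SQ4) = u.sq4 := by
  simp [hBase, hq_ne h]
/-- Reading `SQ5` of the base. [folklore] -/
@[simp] theorem hBase_SQ5 : hBase h T u (h .SQ5) = u.sq5 := by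
  simp [hBase, hq_ne h]
/-- Reading `RX1` of the base. [folklore] -/
@[simp] theorem hBase_RX1 : hBase h T u (h .RX1) = u.rx1 := by
  simp [hBase, hq_ne h]
/-- Reading `RX2` of the base. [folklore] -/
@[simp] theorem hBase_RX2 : hBase h T u (h .RX2) = u.rx2 := by
  simp [hBase, hq_ne h]
/-- Reading `RX3` of the base. [folklore] -/
@[simp] theorem hBase_RX3 : hBase h T u (h .RX3) = u.rx3 := by
  simp [hBase, hq_ne h]
/-- Reading `RX4` of the base. [folklore] -/
@[simp] theorem hBase_RX4 : hBase h T u (h .RX4) = u.rx4 := by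
  simp [hBase, hq_ne h]
/-- Reading `RX5` of the base. [folklore] -/
@[simp] theorem hBase_RX5 : hBase h T u (h .RX5) = u.rx5 := by
  simp [hBase, hq_ne h]
/-- Reading `RX6` of the base. [folklore] -/
@[simp] theorem hBase_RX6 : hBase h T u (h .RX6) = u.rx6 := by
  simp [hBase, hq_ne h]
/-- Reading `RX7` of the base. [folklore] -/
@[simp] theorem hBase_RX7 : hBase h T u (h .RX7) = u.rx7 := by
  simp [hBase, hq_ne h]
/-- Reading `RX8` of the base. [folklore] -/
@[simp] theorem hBase_RX8 : hBase h T u (h .RX8) = u.rx8 := by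
  simp [hBase, hq_ne h]
/-- Reading `RX9` of the base. [folklore] -/
@[simp] theorem hBase_RX9 : hBase h T u (h .RX9) = u.rx9 := by
  simp [hBase, hq_ne h]
/-- Reading `PTK` of the base. [folklore] -/
@[simp] theorem hBase_PTK : hBase h T u (h .PTK) = u.ptk := by
  simp [hBase, hq_ne h]
/-- Reading `PTU` of the base. [folklore] -/
@[simp] theorem hBase_PTU : hBase h T u (h .PTU) = u.ptu := by
  simp [hBase, hq_ne h]
/-- Reading `BLF` of the base. [folklore] -/
@[simp] theorem hBase_BLF : hBase h T u (h .BLF) = u.blf := by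
  simp [hBase, hq_ne h]
/-- Reading `BLA` of the base. [folklore] -/
@[simp] theorem hBase_BLA : hBase h T u (h .BLA) = u.bla := by
  simp [hBase, hq_ne h]
/-- Reading `BLM` of the base. [folklore] -/
@[simp] theorem hBase_BLM : hBase h T u (h .BLM) = u.blm := by
  simp [hBase, hq_ne h]
/-- Reading `BLMU` of the base. [folklore] -/
@[simp] theorem hBase_BLMU : hBase h T u (h .BLMU) = u.blmu := by
  simp [hBase, hq_ne h]
/-- Reading `BLE` of the base. [folklore] -/
@[simp] theorem hBase_BLE : hBase h T u (h .BLE) = u.ble := by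
  simp [hBase, hq_ne h]
/-- Reading `BLPOW` of the base. [folklore] -/
@[simp] theorem hBase_BLPOW : hBase h T u (h .BLPOW) = u.blpow := by
  simp [hBase, hq_ne h]
/-- Reading `BLC1` of the base. [folklore] -/
@[simp] theorem hBase_BLC1 : hBase h T u (h .BLC1) = u.blc1 := by
  simp [hBase, hq_ne h]
/-- Reading `BLC2` of the base. [folklore] -/
@[simp] theorem hBase_BLC2 : hBase h T u (h .BLC2) = u.blc2 := by
  simp [hBase, hq_ne h]
/-- Reading `BLFP` of the base. [folklore] -/
@[simp] theorem hBase_BLFP : hBase h T u (h .BLFP) = u.blfp := by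
  simp [hBase, hq_ne h]
/-- Reading `BLG` of the base. [folklore] -/
@[simp] theorem hBase_BLG : hBase h T u (h .BLG) = u.blg := by
  simp [hBase, hq_ne h]
/-- Reading `BLOUT` of the base. [folklore] -/
@[simp] theorem hBase_BLOUT : hBase h T u (h .BLOUT) = u.blout := by
  simp [hBase, hq_ne h]
/-- Reading `BLK` of the base. [folklore] -/
@[simp] theorem hBase_BLK : hBase h T u (h .BLK) = u.blk := by
  simp [hBase, hq_ne h]
/-- Reading `A1V` of the base. [folklore] -/
@[simp] theorem hBase_A1V : hBase h T u (h .A1V) = u.a1v := by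
  simp [hBase, hq_ne h]
/-- Reading `A1I` of the base. [folklore] -/
@[simp] theorem hBase_A1I : hBase h T u (h .A1I) = u.a1i := by
  simp [hBase, hq_ne h]
/-- Reading `A1AI` of the base. [folklore] -/
@[simp] theorem hBase_A1AI : hBase h T u (h .A1AI) = u.a1ai := by
  simp [hBase, hq_ne h]
/-- Reading `A1G` of the base. [folklore] -/
@[simp] theorem hBase_A1G : hBase h T u (h .A1G) = u.a1g := by
  simp [hBase, hq_ne h]
/-- Reading `A1P` of the base. [folklore] -/
@[simp] theorem hBase_A1P : hBase h T u (h .A1P) = u.a1p := by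
  simp [hBase, hq_ne h]
/-- Reading `A1C` of the base. [folklore] -/
@[simp] theorem hBase_A1C : hBase h T u (h .A1C) = u.a1c := by
  simp [hBase, hq_ne h]
/-- Reading `A2R` of the base. [folklore] -/
@[simp] theorem hBase_A2R : hBase h T u (h .A2R) = u.a2r := by
  simp [hBase, hq_ne h]
/-- Reading `A2M` of the base. [folklore] -/
@[simp] theorem hBase_A2M : hBase h T u (h .A2M) = u.a2m := by
  simp [hBase, hq_ne h]
/-- Reading `A2AL` of the base. [folklore] -/
@[simp] theorem hBase_A2AL : hBase h T u (h .A2AL) = u.a2al := by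
  simp [hBase, hq_ne h]
/-- Reading `A2AM` of the base. [folklore] -/
@[simp] theorem hBase_A2AM : hBase h T u (h .A2AM) = u.a2am := by
  simp [hBase, hq_ne h]
/-- Reading `A2C` of the base. [folklore] -/
@[simp] theorem hBase_A2C : hBase h T u (h .A2C) = u.a2c := by
  simp [hBase, hq_ne h]
/-- Reading `A2J` of the base. [folklore] -/
@[simp] theorem hBase_A2J : hBase h T u (h .A2J) = u.a2j := by
  simp [hBase, hq_ne h]
/-- Reading `A2A` of the base. [folklore] -/
@[simp] theorem hBase_A2A : hBase h T u (h .A2A) = u.a2a := by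
  simp [hBase, hq_ne h]
/-- Reading `A2B` of the base. [folklore] -/
@[simp] theorem hBase_A2B : hBase h T u (h .A2B) = u.a2b := by
  simp [hBase, hq_ne h]
/-- Reading `A2JJ` of the base. [folklore] -/
@[simp] theorem hBase_A2JJ : hBase h T u (h .A2JJ) = u.a2jj := by
  simp [hBase, hq_ne h]
/-- Reading `A2T` of the base. [folklore] -/
@[simp] theorem hBase_A2T : hBase h T u (h .A2T) = u.a2t := by
  simp [hBase, hq_ne h]
/-- Reading `A2V` of the base. [folklore] -/
@[simp] theorem hBase_A2V : hBase h T u (h .A2V) = u.a2v := by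
  simp [hBase, hq_ne h]
/-- Reading `A2S` of the base. [folklore] -/
@[simp] theorem hBase_A2S : hBase h T u (h .A2S) = u.a2s := by
  simp [hBase, hq_ne h]
/-- Reading `A2L1` of the base. [folklore] -/
@[simp] theorem hBase_A2L1 : hBase h T u (h .A2L1) = u.a2l1 := by
  simp [hBase, hq_ne h]
/-- Reading `A2L2` of the base. [folklore] -/
@[simp] theorem hBase_A2L2 : hBase h T u (h .A2L2) = u.a2l2 := by
  simp [hBase, hq_ne h]
/-- Reading `A2SRT` of the base. [folklore] -/
@[simp] theorem hBase_A2SRT : hBase h T u (h .A2SRT) = u.a2srt := by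
  simp [hBase, hq_ne h]
/-- Reading `A2U` of the base. [folklore] -/
@[simp] theorem hBase_A2U : hBase h T u (h .A2U) = u.a2u := by
  simp [hBase, hq_ne h]
/-- Reading `A2D` of the base. [folklore] -/
@[simp] theorem hBase_A2D : hBase h T u (h .A2D) = u.a2d := by
  simp [hBase, hq_ne h]
/-- Reading `A2Y` of the base. [folklore] -/
@[simp] theorem hBase_A2Y : hBase h T u (h .A2Y) = u.a2y := by
  simp [hBase, hq_ne h]
/-- Reading `A2P` of the base. [folklore] -/
@[simp] theorem hBase_A2P : hBase h T u (h .A2P) = u.a2p := by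
  simp [hBase, hq_ne h]
/-- Reading `A2Q` of the base. [folklore] -/
@[simp] theorem hBase_A2Q : hBase h T u (h .A2Q) = u.a2q := by
  simp [hBase, hq_ne h]
/-- Reading `SFM` of the base. [folklore] -/
@[simp] theorem hBase_SFM : hBase h T u (h .SFM) = u.sfm := by
  simp [hBase, hq_ne h]
/-- Reading `SFD` of the base. [folklore] -/
@[simp] theorem hBase_SFD : hBase h T u (h .SFD) = u.sfd := by
  simp [hBase, hq_ne h]
/-- Reading `SFB` of the base. [folklore] -/
@[simp] theorem hBase_SFB : hBase h T u (h .SFB) = u.sfb := by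
  simp [hBase, hq_ne h]
/-- Reading `SFBMAX` of the base. [folklore] -/
@[simp] theorem hBase_SFBMAX : hBase h T u (h .SFBMAX) = u.sfbmax := by
  simp [hBase, hq_ne h]
/-- Reading `SFL` of the base. [folklore] -/
@[simp] theorem hBase_SFL : hBase h T u (h .SFL) = u.sfl := by
  simp [hBase, hq_ne h]
/-- Reading `SFK` of the base. [folklore] -/
@[simp] theorem hBase_SFK : hBase h T u (h .SFK) = u.sfk := by
  simp [hBase, hq_ne h]
/-- Reading `SFDIVS` of the base. [folklore] -/
@[simp] theorem hBase_SFDIVS : hBase h T u (h .SFDIVS) = u.sfdivs := by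
  simp [hBase, hq_ne h]
/-- Reading `SFT` of the base. [folklore] -/
@[simp] theorem hBase_SFT : hBase h T u (h .SFT) = u.sft := by
  simp [hBase, hq_ne h]
/-- Reading `SFCAND` of the base. [folklore] -/
@[simp] theorem hBase_SFCAND : hBase h T u (h .SFCAND) = u.sfcand := by
  simp [hBase, hq_ne h]
/-- Reading `SFBETA` of the base. [folklore] -/
@[simp] theorem hBase_SFBETA : hBase h T u (h .SFBETA) = u.sfbeta := by
  simp [hBase, hq_ne h]
/-- Reading `SFE` of the base. [folklore] -/
@[simp] theorem hBase_SFE : hBase h T u (h .SFE) = u.sfe := by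
  simp [hBase, hq_ne h]
/-- Reading `SFR` of the base. [folklore] -/
@[simp] theorem hBase_SFR : hBase h T u (h .SFR) = u.sfr := by
  simp [hBase, hq_ne h]
/-- Reading `MN0` of the base. [folklore] -/
@[simp] theorem hBase_MN0 : hBase h T u (h .MN0) = u.mn0 := by
  simp [hBase, hq_ne h]
/-- Reading `MNC` of the base. [folklore] -/
@[simp] theorem hBase_MNC : hBase h T u (h .MNC) = u.mnc := by
  simp [hBase, hq_ne h]
/-- Reading `MNF` of the base. [folklore] -/
@[simp] theorem hBase_MNF : hBase h T u (h .MNF) = u.mnf := by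
  simp [hBase, hq_ne h]
/-- Reading `MNP` of the base. [folklore] -/
@[simp] theorem hBase_MNP : hBase h T u (h .MNP) = u.mnp := by
  simp [hBase, hq_ne h]
/-- Reading `MNB` of the base. [folklore] -/
@[simp] theorem hBase_MNB : hBase h T u (h .MNB) = u.mnb := by
  simp [hBase, hq_ne h]
/-- Reading `MNI` of the base. [folklore] -/
@[simp] theorem hBase_MNI : hBase h T u (h .MNI) = u.mni := by
  simp [hBase, hq_ne h]
/-- Reading `INP` of the base. [folklore] -/
@[simp] theorem hBase_INP : hBase h T u (h .INP) = u.inp := by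
  simp [hBase, hq_ne h]
/-- Reading `OUTP` of the base. [folklore] -/
@[simp] theorem hBase_OUTP : hBase h T u (h .OUTP) = u.outp := by
  simp [hBase]
/-- Reading a multiplier register of the base. [folklore] -/
@[simp] theorem hBase_g (y : GReg) : hBase h T u (h (.g y)) = T (h (.g y)) := by
  simp [hBase, hq_ne h]
/-- Writing `X1` of the base. [folklore] -/
@[simp] theorem update_hBase_X1 : Function.update (hBase h T u) (h .X1) v = hBase h T { u with x1 := v } := by
  funext y
  simp only [hBase, Function.update_apply]
  by_cases hy : y = (h .X1) <;> simp [hy, hq_ne h]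
/-- Writing `X2` of the base. [folklore] -/
@[simp] theorem update_hBase_X2 : Function.update (hBase h T u) (h .X2) v = hBase h T { u with x2 := v } := by
  funext y
  simp only [hBase, Function.update_apply]
  by_cases hy : y = (h .X2) <;> simp [hy, hq_ne h]
/-- Writing `X3` of the base. [folklore] -/
@[simp] theorem update_hBase_X3 : Function.update (hBase h T u) (h .X3) v = hBase h T { u with x3 := v } := by
  funext y
  simp only [hBase, Function.update_apply]
  by_cases hy : y = (h .X3) <;> simp [hy, hq_ne h]
/-- Writing `X4` of the base. [folklore] -/
@[simp] theorem update_hBase_X4 : Function.update (hBase h T u) (h .X4) v = hBase h T { u with x4 := v } := by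
  funext y
  simp only [hBase, Function.update_apply]
  by_cases hy : y = (h .X4) <;> simp [hy, hq_ne h]
/-- Writing `X5` of the base. [folklore] -/
@[simp] theorem update_hBase_X5 : Function.update (hBase h T u) (h .X5) v = hBase h T { u with x5 := v } := by
  funext y
  simp only [hBase, Function.update_apply]
  by_cases hy : y = (h .X5) <;> simp [hy, hq_ne h]
/-- Writing `X6` of the base. [folklore] -/
@[simp] theorem update_hBase_X6 : Function.update (hBase h T u) (h .X6) v = hBase h T { u with x6 := v } := by
  funext y
  simp only [hBase, Function.update_apply]
  by_cases hy : y = (h .X6) <;> simp [hy, hq_ne h]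
/-- Writing `FL1` of the base. [folklore] -/
@[simp] theorem update_hBase_FL1 : Function.update (hBase h T u) (h .FL1) v = hBase h T { u with fl1 := v } := by
  funext y
  simp only [hBase, Function.update_apply]
  by_cases hy : y = (h .FL1) <;> simp [hy, hq_ne h]
/-- Writing `FL2` of the base. [folklore] -/
@[simp] theorem update_hBase_FL2 : Function.update (hBase h T u) (h .FL2) v = hBase h T { u with fl2 := v } := by
  funext y
  simp only [hBase, Function.update_apply]
  by_cases hy : y = (h .FL2) <;> simp [hy, hq_ne h]
/-- Writing `U1` of the base. [folklore] -/
@[simp] theorem update_hBase_U1 : Function.update (hBase h T u) (h .U1) v = hBase h T { u with u1 := v } := by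
  funext y
  simp only [hBase, Function.update_apply]
  by_cases hy : y = (h .U1) <;> simp [hy, hq_ne h]
/-- Writing `U2` of the base. [folklore] -/
@[simp] theorem update_hBase_U2 : Function.update (hBase h T u) (h .U2) v = hBase h T { u with u2 := v } := by
  funext y
  simp only [hBase, Function.update_apply]
  by_cases hy : y = (h .U2) <;> simp [hy, hq_ne h]
/-- Writing `L1` of the base. [folklore] -/
@[simp] theorem update_hBase_L1 : Function.update (hBase h T u) (h .L1) v = hBase h T { u with l1 := v } := by
  funext y
  simp only [hBase, Function.update_apply]
  by_cases hy : y = (h .L1) <;> simp [hy, hq_ne h]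
/-- Writing `L2` of the base. [folklore] -/
@[simp] theorem update_hBase_L2 : Function.update (hBase h T u) (h .L2) v = hBase h T { u with l2 := v } := by
  funext y
  simp only [hBase, Function.update_apply]
  by_cases hy : y = (h .L2) <;> simp [hy, hq_ne h]
/-- Writing `L3` of the base. [folklore] -/
@[simp] theorem update_hBase_L3 : Function.update (hBase h T u) (h .L3) v = hBase h T { u with l3 := v } := by
  funext y
  simp only [hBase, Function.update_apply]
  by_cases hy : y = (h .L3) <;> simp [hy, hq_ne h]
/-- Writing `L4` of the base. [folklore] -/
@[simp] theorem update_hBase_L4 : Function.update (hBase h T u) (h .L4) v = hBase h T { u with l4 := v } := by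
  funext y
  simp only [hBase, Function.update_apply]
  by_cases hy : y = (h .L4) <;> simp [hy, hq_ne h]
/-- Writing `SQ1` of the base. [folklore] -/
@[simp] theorem update_hBase_SQ1 : Function.update (hBase h T u) (h .SQ1) v = hBase h T { u with sq1 := v } := by
  funext y
  simp only [hBase, Function.update_apply]
  by_cases hy : y = (h .SQ1) <;> simp [hy, hq_ne h]
/-- Writing `SQ2` of the base. [folklore] -/
@[simp] theorem update_hBase_SQ2 : Function.update (hBase h T u) (h .SQ2) v = hBase h T { u with sq2 := v } := by
  funext y
  simp only [hBase, Function.update_apply]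
  by_cases hy : y = (h .SQ2) <;> simp [hy, hq_ne h]
/-- Writing `SQ3` of the base. [folklore] -/
@[simp] theorem update_hBase_SQ3 : Function.update (hBase h T u) (h .SQ3) v = hBase h T { u with sq3 := v } := by
  funext y
  simp only [hBase, Function.update_apply]
  by_cases hy : y = (h .SQ3) <;> simp [hy, hq_ne h]
/-- Writing `SQ4` of the base. [folklore] -/
@[simp] theorem update_hBase_SQ4 : Function.update (hBase h T u) (h .SQ4) v = hBase h T { u with sq4 := v } := by
  funext y
  simp only [hBase, Function.update_apply]
  by_cases hy : y = (h .SQ4) <;> simp [hy, hq_ne h]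
/-- Writing `SQ5` of the base. [folklore] -/
@[simp] theorem update_hBase_SQ5 : Function.update (hBase h T u) (h .SQ5) v = hBase h T { u with sq5 := v } := by
  funext y
  simp only [hBase, Function.update_apply]
  by_cases hy : y = (h .SQ5) <;> simp [hy, hq_ne h]
/-- Writing `RX1` of the base. [folklore] -/
@[simp] theorem update_hBase_RX1 : Function.update (hBase h T u) (h .RX1) v = hBase h T { u with rx1 := v } := by
  funext y
  simp only [hBase, Function.update_apply]
  by_cases hy : y = (h .RX1) <;> simp [hy, hq_ne h]
/-- Writing `RX2` of the base. [folklore] -/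
@[simp] theorem update_hBase_RX2 : Function.update (hBase h T u) (h .RX2) v = hBase h T { u with rx2 := v } := by
  funext y
  simp only [hBase, Function.update_apply]
  by_cases hy : y = (h .RX2) <;> simp [hy, hq_ne h]
/-- Writing `RX3` of the base. [folklore] -/
@[simp] theorem update_hBase_RX3 : Function.update (hBase h T u) (h .RX3) v = hBase h T { u with rx3 := v } := by
  funext y
  simp only [hBase, Function.update_apply]
  by_cases hy : y = (h .RX3) <;> simp [hy, hq_ne h]
/-- Writing `RX4` of the base. [folklore] -/
@[simp] theorem update_hBase_RX4 : Function.update (hBase h T u) (h .RX4) v = hBase h T { u with rx4 := v } := by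
  funext y
  simp only [hBase, Function.update_apply]
  by_cases hy : y = (h .RX4) <;> simp [hy, hq_ne h]
/-- Writing `RX5` of the base. [folklore] -/
@[simp] theorem update_hBase_RX5 : Function.update (hBase h T u) (h .RX5) v = hBase h T { u with rx5 := v } := by
  funext y
  simp only [hBase, Function.update_apply]
  by_cases hy : y = (h .RX5) <;> simp [hy, hq_ne h]
/-- Writing `RX6` of the base. [folklore] -/
@[simp] theorem update_hBase_RX6 : Function.update (hBase h T u) (h .RX6) v = hBase h T { u with rx6 := v } := by
  funext y
  simp only [hBase, Function.update_apply]
  by_cases hy : y = (h .RX6) <;> simp [hy, hq_ne h]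
/-- Writing `RX7` of the base. [folklore] -/
@[simp] theorem update_hBase_RX7 : Function.update (hBase h T u) (h .RX7) v = hBase h T { u with rx7 := v } := by
  funext y
  simp only [hBase, Function.update_apply]
  by_cases hy : y = (h .RX7) <;> simp [hy, hq_ne h]
/-- Writing `RX8` of the base. [folklore] -/
@[simp] theorem update_hBase_RX8 : Function.update (hBase h T u) (h .RX8) v = hBase h T { u with rx8 := v } := by
  funext y
  simp only [hBase, Function.update_apply]
  by_cases hy : y = (h .RX8) <;> simp [hy, hq_ne h]
/-- Writing `RX9` of the base. [folklore] -/
@[simp] theorem update_hBase_RX9 : Function.update (hBase h T u) (h .RX9) v = hBase h T { u with rx9 := v } := by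
  funext y
  simp only [hBase, Function.update_apply]
  by_cases hy : y = (h .RX9) <;> simp [hy, hq_ne h]
/-- Writing `PTK` of the base. [folklore] -/
@[simp] theorem update_hBase_PTK : Function.update (hBase h T u) (h .PTK) v = hBase h T { u with ptk := v } := by
  funext y
  simp only [hBase, Function.update_apply]
  by_cases hy : y = (h .PTK) <;> simp [hy, hq_ne h]
/-- Writing `PTU` of the base. [folklore] -/
@[simp] theorem update_hBase_PTU : Function.update (hBase h T u) (h .PTU) v = hBase h T { u with ptu := v } := by
  funext y
  simp only [hBase, Function.update_apply]
  by_cases hy : y = (h .PTU) <;> simp [hy, hq_ne h]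
/-- Writing `BLF` of the base. [folklore] -/
@[simp] theorem update_hBase_BLF : Function.update (hBase h T u) (h .BLF) v = hBase h T { u with blf := v } := by
  funext y
  simp only [hBase, Function.update_apply]
  by_cases hy : y = (h .BLF) <;> simp [hy, hq_ne h]
/-- Writing `BLA` of the base. [folklore] -/
@[simp] theorem update_hBase_BLA : Function.update (hBase h T u) (h .BLA) v = hBase h T { u with bla := v } := by
  funext y
  simp only [hBase, Function.update_apply]
  by_cases hy : y = (h .BLA) <;> simp [hy, hq_ne h]
/-- Writing `BLM` of the base. [folklore] -/
@[simp] theorem update_hBase_BLM : Function.update (hBase h T u) (h .BLM) v = hBase h T { u with blm := v } := by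
  funext y
  simp only [hBase, Function.update_apply]
  by_cases hy : y = (h .BLM) <;> simp [hy, hq_ne h]
/-- Writing `BLMU` of the base. [folklore] -/
@[simp] theorem update_hBase_BLMU : Function.update (hBase h T u) (h .BLMU) v = hBase h T { u with blmu := v } := by
  funext y
  simp only [hBase, Function.update_apply]
  by_cases hy : y = (h .BLMU) <;> simp [hy, hq_ne h]
/-- Writing `BLE` of the base. [folklore] -/
@[simp] theorem update_hBase_BLE : Function.update (hBase h T u) (h .BLE) v = hBase h T { u with ble := v } := by
  funext y
  simp only [hBase, Function.update_apply]
  by_cases hy : y = (h .BLE) <;> simp [hy, hq_ne h]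
/-- Writing `BLPOW` of the base. [folklore] -/
@[simp] theorem update_hBase_BLPOW : Function.update (hBase h T u) (h .BLPOW) v = hBase h T { u with blpow := v } := by
  funext y
  simp only [hBase, Function.update_apply]
  by_cases hy : y = (h .BLPOW) <;> simp [hy, hq_ne h]
/-- Writing `BLC1` of the base. [folklore] -/
@[simp] theorem update_hBase_BLC1 : Function.update (hBase h T u) (h .BLC1) v = hBase h T { u with blc1 := v } := by
  funext y
  simp only [hBase, Function.update_apply]
  by_cases hy : y = (h .BLC1) <;> simp [hy, hq_ne h]
/-- Writing `BLC2` of the base. [folklore] -/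
@[simp] theorem update_hBase_BLC2 : Function.update (hBase h T u) (h .BLC2) v = hBase h T { u with blc2 := v } := by
  funext y
  simp only [hBase, Function.update_apply]
  by_cases hy : y = (h .BLC2) <;> simp [hy, hq_ne h]
/-- Writing `BLFP` of the base. [folklore] -/
@[simp] theorem update_hBase_BLFP : Function.update (hBase h T u) (h .BLFP) v = hBase h T { u with blfp := v } := by
  funext y
  simp only [hBase, Function.update_apply]
  by_cases hy : y = (h .BLFP) <;> simp [hy, hq_ne h]
/-- Writing `BLG` of the base. [folklore] -/
@[simp] theorem update_hBase_BLG : Function.update (hBase h T u) (h .BLG) v = hBase h T { u with blg := v } := by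
  funext y
  simp only [hBase, Function.update_apply]
  by_cases hy : y = (h .BLG) <;> simp [hy, hq_ne h]
/-- Writing `BLOUT` of the base. [folklore] -/
@[simp] theorem update_hBase_BLOUT : Function.update (hBase h T u) (h .BLOUT) v = hBase h T { u with blout := v } := by
  funext y
  simp only [hBase, Function.update_apply]
  by_cases hy : y = (h .BLOUT) <;> simp [hy, hq_ne h]
/-- Writing `BLK` of the base. [folklore] -/
@[simp] theorem update_hBase_BLK : Function.update (hBase h T u) (h .BLK) v = hBase h T { u with blk := v } := by
  funext y
  simp only [hBase, Function.update_apply]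
  by_cases hy : y = (h .BLK) <;> simp [hy, hq_ne h]
/-- Writing `A1V` of the base. [folklore] -/
@[simp] theorem update_hBase_A1V : Function.update (hBase h T u) (h .A1V) v = hBase h T { u with a1v := v } := by
  funext y
  simp only [hBase, Function.update_apply]
  by_cases hy : y = (h .A1V) <;> simp [hy, hq_ne h]
/-- Writing `A1I` of the base. [folklore] -/
@[simp] theorem update_hBase_A1I : Function.update (hBase h T u) (h .A1I) v = hBase h T { u with a1i := v } := by
  funext y
  simp only [hBase, Function.update_apply]
  by_cases hy : y = (h .A1I) <;> simp [hy, hq_ne h]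
/-- Writing `A1AI` of the base. [folklore] -/
@[simp] theorem update_hBase_A1AI : Function.update (hBase h T u) (h .A1AI) v = hBase h T { u with a1ai := v } := by
  funext y
  simp only [hBase, Function.update_apply]
  by_cases hy : y = (h .A1AI) <;> simp [hy, hq_ne h]
/-- Writing `A1G` of the base. [folklore] -/
@[simp] theorem update_hBase_A1G : Function.update (hBase h T u) (h .A1G) v = hBase h T { u with a1g := v } := by
  funext y
  simp only [hBase, Function.update_apply]
  by_cases hy : y = (h .A1G) <;> simp [hy, hq_ne h]
/-- Writing `A1P` of the base. [folklore] -/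
@[simp] theorem update_hBase_A1P : Function.update (hBase h T u) (h .A1P) v = hBase h T { u with a1p := v } := by
  funext y
  simp only [hBase, Function.update_apply]
  by_cases hy : y = (h .A1P) <;> simp [hy, hq_ne h]
/-- Writing `A1C` of the base. [folklore] -/
@[simp] theorem update_hBase_A1C : Function.update (hBase h T u) (h .A1C) v = hBase h T { u with a1c := v } := by
  funext y
  simp only [hBase, Function.update_apply]
  by_cases hy : y = (h .A1C) <;> simp [hy, hq_ne h]
/-- Writing `A2R` of the base. [folklore] -/
@[simp] theorem update_hBase_A2R : Function.update (hBase h T u) (h .A2R) v = hBase h T { u with a2r := v } := by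
  funext y
  simp only [hBase, Function.update_apply]
  by_cases hy : y = (h .A2R) <;> simp [hy, hq_ne h]
/-- Writing `A2M` of the base. [folklore] -/
@[simp] theorem update_hBase_A2M : Function.update (hBase h T u) (h .A2M) v = hBase h T { u with a2m := v } := by
  funext y
  simp only [hBase, Function.update_apply]
  by_cases hy : y = (h .A2M) <;> simp [hy, hq_ne h]
/-- Writing `A2AL` of the base. [folklore] -/
@[simp] theorem update_hBase_A2AL : Function.update (hBase h T u) (h .A2AL) v = hBase h T { u with a2al := v } := by
  funext y
  simp only [hBase, Function.update_apply]
  by_cases hy : y = (h .A2AL) <;> simp [hy, hq_ne h]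
/-- Writing `A2AM` of the base. [folklore] -/
@[simp] theorem update_hBase_A2AM : Function.update (hBase h T u) (h .A2AM) v = hBase h T { u with a2am := v } := by
  funext y
  simp only [hBase, Function.update_apply]
  by_cases hy : y = (h .A2AM) <;> simp [hy, hq_ne h]
/-- Writing `A2C` of the base. [folklore] -/
@[simp] theorem update_hBase_A2C : Function.update (hBase h T u) (h .A2C) v = hBase h T { u with a2c := v } := by
  funext y
  simp only [hBase, Function.update_apply]
  by_cases hy : y = (h .A2C) <;> simp [hy, hq_ne h]
/-- Writing `A2J` of the base. [folklore] -/
@[simp] theorem update_hBase_A2J : Function.update (hBase h T u) (h .A2J) v = hBase h T { u with a2j := v } := by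
  funext y
  simp only [hBase, Function.update_apply]
  by_cases hy : y = (h .A2J) <;> simp [hy, hq_ne h]
/-- Writing `A2A` of the base. [folklore] -/
@[simp] theorem update_hBase_A2A : Function.update (hBase h T u) (h .A2A) v = hBase h T { u with a2a := v } := by
  funext y
  simp only [hBase, Function.update_apply]
  by_cases hy : y = (h .A2A) <;> simp [hy, hq_ne h]
/-- Writing `A2B` of the base. [folklore] -/
@[simp] theorem update_hBase_A2B : Function.update (hBase h T u) (h .A2B) v = hBase h T { u with a2b := v } := by
  funext y
  simp only [hBase, Function.update_apply]
  by_cases hy : y = (h .A2B) <;> simp [hy, hq_ne h]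
/-- Writing `A2JJ` of the base. [folklore] -/
@[simp] theorem update_hBase_A2JJ : Function.update (hBase h T u) (h .A2JJ) v = hBase h T { u with a2jj := v } := by
  funext y
  simp only [hBase, Function.update_apply]
  by_cases hy : y = (h .A2JJ) <;> simp [hy, hq_ne h]
/-- Writing `A2T` of the base. [folklore] -/
@[simp] theorem update_hBase_A2T : Function.update (hBase h T u) (h .A2T) v = hBase h T { u with a2t := v } := by
  funext y
  simp only [hBase, Function.update_apply]
  by_cases hy : y = (h .A2T) <;> simp [hy, hq_ne h]
/-- Writing `A2V` of the base. [folklore] -/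
@[simp] theorem update_hBase_A2V : Function.update (hBase h T u) (h .A2V) v = hBase h T { u with a2v := v } := by
  funext y
  simp only [hBase, Function.update_apply]
  by_cases hy : y = (h .A2V) <;> simp [hy, hq_ne h]
/-- Writing `A2S` of the base. [folklore] -/
@[simp] theorem update_hBase_A2S : Function.update (hBase h T u) (h .A2S) v = hBase h T { u with a2s := v } := by
  funext y
  simp only [hBase, Function.update_apply]
  by_cases hy : y = (h .A2S) <;> simp [hy, hq_ne h]
/-- Writing `A2L1` of the base. [folklore] -/
@[simp] theorem update_hBase_A2L1 : Function.update (hBase h T u) (h .A2L1) v = hBase h T { u with a2l1 := v } := by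
  funext y
  simp only [hBase, Function.update_apply]
  by_cases hy : y = (h .A2L1) <;> simp [hy, hq_ne h]
/-- Writing `A2L2` of the base. [folklore] -/
@[simp] theorem update_hBase_A2L2 : Function.update (hBase h T u) (h .A2L2) v = hBase h T { u with a2l2 := v } := by
  funext y
  simp only [hBase, Function.update_apply]
  by_cases hy : y = (h .A2L2) <;> simp [hy, hq_ne h]
/-- Writing `A2SRT` of the base. [folklore] -/
@[simp] theorem update_hBase_A2SRT : Function.update (hBase h T u) (h .A2SRT) v = hBase h T { u with a2srt := v } := by
  funext y
  simp only [hBase, Function.update_apply]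
  by_cases hy : y = (h .A2SRT) <;> simp [hy, hq_ne h]
/-- Writing `A2U` of the base. [folklore] -/
@[simp] theorem update_hBase_A2U : Function.update (hBase h T u) (h .A2U) v = hBase h T { u with a2u := v } := by
  funext y
  simp only [hBase, Function.update_apply]
  by_cases hy : y = (h .A2U) <;> simp [hy, hq_ne h]
/-- Writing `A2D` of the base. [folklore] -/
@[simp] theorem update_hBase_A2D : Function.update (hBase h T u) (h .A2D) v = hBase h T { u with a2d := v } := by
  funext y
  simp only [hBase, Function.update_apply]
  by_cases hy : y = (h .A2D) <;> simp [hy, hq_ne h]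
/-- Writing `A2Y` of the base. [folklore] -/
@[simp] theorem update_hBase_A2Y : Function.update (hBase h T u) (h .A2Y) v = hBase h T { u with a2y := v } := by
  funext y
  simp only [hBase, Function.update_apply]
  by_cases hy : y = (h .A2Y) <;> simp [hy, hq_ne h]
/-- Writing `A2P` of the base. [folklore] -/
@[simp] theorem update_hBase_A2P : Function.update (hBase h T u) (h .A2P) v = hBase h T { u with a2p := v } := by
  funext y
  simp only [hBase, Function.update_apply]
  by_cases hy : y = (h .A2P) <;> simp [hy, hq_ne h]
/-- Writing `A2Q` of the base. [folklore] -/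
@[simp] theorem update_hBase_A2Q : Function.update (hBase h T u) (h .A2Q) v = hBase h T { u with a2q := v } := by
  funext y
  simp only [hBase, Function.update_apply]
  by_cases hy : y = (h .A2Q) <;> simp [hy, hq_ne h]
/-- Writing `SFM` of the base. [folklore] -/
@[simp] theorem update_hBase_SFM : Function.update (hBase h T u) (h .SFM) v = hBase h T { u with sfm := v } := by
  funext y
  simp only [hBase, Function.update_apply]
  by_cases hy : y = (h .SFM) <;> simp [hy, hq_ne h]
/-- Writing `SFD` of the base. [folklore] -/
@[simp] theorem update_hBase_SFD : Function.update (hBase h T u) (h .SFD) v = hBase h T { u with sfd := v } := by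
  funext y
  simp only [hBase, Function.update_apply]
  by_cases hy : y = (h .SFD) <;> simp [hy, hq_ne h]
/-- Writing `SFB` of the base. [folklore] -/
@[simp] theorem update_hBase_SFB : Function.update (hBase h T u) (h .SFB) v = hBase h T { u with sfb := v } := by
  funext y
  simp only [hBase, Function.update_apply]
  by_cases hy : y = (h .SFB) <;> simp [hy, hq_ne h]
/-- Writing `SFBMAX` of the base. [folklore] -/
@[simp] theorem update_hBase_SFBMAX : Function.update (hBase h T u) (h .SFBMAX) v = hBase h T { u with sfbmax := v } := by
  funext y
  simp only [hBase, Function.update_apply]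
  by_cases hy : y = (h .SFBMAX) <;> simp [hy, hq_ne h]
/-- Writing `SFL` of the base. [folklore] -/
@[simp] theorem update_hBase_SFL : Function.update (hBase h T u) (h .SFL) v = hBase h T { u with sfl := v } := by
  funext y
  simp only [hBase, Function.update_apply]
  by_cases hy : y = (h .SFL) <;> simp [hy, hq_ne h]
/-- Writing `SFK` of the base. [folklore] -/
@[simp] theorem update_hBase_SFK : Function.update (hBase h T u) (h .SFK) v = hBase h T { u with sfk := v } := by
  funext y
  simp only [hBase, Function.update_apply]
  by_cases hy : y = (h .SFK) <;> simp [hy, hq_ne h]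
/-- Writing `SFDIVS` of the base. [folklore] -/
@[simp] theorem update_hBase_SFDIVS : Function.update (hBase h T u) (h .SFDIVS) v = hBase h T { u with sfdivs := v } := by
  funext y
  simp only [hBase, Function.update_apply]
  by_cases hy : y = (h .SFDIVS) <;> simp [hy, hq_ne h]
/-- Writing `SFT` of the base. [folklore] -/
@[simp] theorem update_hBase_SFT : Function.update (hBase h T u) (h .SFT) v = hBase h T { u with sft := v } := by
  funext y
  simp only [hBase, Function.update_apply]
  by_cases hy : y = (h .SFT) <;> simp [hy, hq_ne h]
/-- Writing `SFCAND` of the base. [folklore] -/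
@[simp] theorem update_hBase_SFCAND : Function.update (hBase h T u) (h .SFCAND) v = hBase h T { u with sfcand := v } := by
  funext y
  simp only [hBase, Function.update_apply]
  by_cases hy : y = (h .SFCAND) <;> simp [hy, hq_ne h]
/-- Writing `SFBETA` of the base. [folklore] -/
@[simp] theorem update_hBase_SFBETA : Function.update (hBase h T u) (h .SFBETA) v = hBase h T { u with sfbeta := v } := by
  funext y
  simp only [hBase, Function.update_apply]
  by_cases hy : y = (h .SFBETA) <;> simp [hy, hq_ne h]
/-- Writing `SFE` of the base. [folklore] -/
@[simp] theorem update_hBase_SFE : Function.update (hBase h T u) (h .SFE) v = hBase h T { u with sfe := v } := by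
  funext y
  simp only [hBase, Function.update_apply]
  by_cases hy : y = (h .SFE) <;> simp [hy, hq_ne h]
/-- Writing `SFR` of the base. [folklore] -/
@[simp] theorem update_hBase_SFR : Function.update (hBase h T u) (h .SFR) v = hBase h T { u with sfr := v } := by
  funext y
  simp only [hBase, Function.update_apply]
  by_cases hy : y = (h .SFR) <;> simp [hy, hq_ne h]
/-- Writing `MN0` of the base. [folklore] -/
@[simp] theorem update_hBase_MN0 : Function.update (hBase h T u) (h .MN0) v = hBase h T { u with mn0 := v } := by
  funext y
  simp only [hBase, Function.update_apply]
  by_cases hy : y = (h .MN0) <;> simp [hy, hq_ne h]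
/-- Writing `MNC` of the base. [folklore] -/
@[simp] theorem update_hBase_MNC : Function.update (hBase h T u) (h .MNC) v = hBase h T { u with mnc := v } := by
  funext y
  simp only [hBase, Function.update_apply]
  by_cases hy : y = (h .MNC) <;> simp [hy, hq_ne h]
/-- Writing `MNF` of the base. [folklore] -/
@[simp] theorem update_hBase_MNF : Function.update (hBase h T u) (h .MNF) v = hBase h T { u with mnf := v } := by
  funext y
  simp only [hBase, Function.update_apply]
  by_cases hy : y = (h .MNF) <;> simp [hy, hq_ne h]
/-- Writing `MNP` of the base. [folklore] -/
@[simp] theorem update_hBase_MNP : Function.update (hBase h T u) (h .MNP) v = hBase h T { u with mnp := v } := by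
  funext y
  simp only [hBase, Function.update_apply]
  by_cases hy : y = (h .MNP) <;> simp [hy, hq_ne h]
/-- Writing `MNB` of the base. [folklore] -/
@[simp] theorem update_hBase_MNB : Function.update (hBase h T u) (h .MNB) v = hBase h T { u with mnb := v } := by
  funext y
  simp only [hBase, Function.update_apply]
  by_cases hy : y = (h .MNB) <;> simp [hy, hq_ne h]
/-- Writing `MNI` of the base. [folklore] -/
@[simp] theorem update_hBase_MNI : Function.update (hBase h T u) (h .MNI) v = hBase h T { u with mni := v } := by
  funext y
  simp only [hBase, Function.update_apply]
  by_cases hy : y = (h .MNI) <;> simp [hy, hq_ne h]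
/-- Writing `INP` of the base. [folklore] -/
@[simp] theorem update_hBase_INP : Function.update (hBase h T u) (h .INP) v = hBase h T { u with inp := v } := by
  funext y
  simp only [hBase, Function.update_apply]
  by_cases hy : y = (h .INP) <;> simp [hy, hq_ne h]
/-- Writing `OUTP` of the base. [folklore] -/
@[simp] theorem update_hBase_OUTP : Function.update (hBase h T u) (h .OUTP) v = hBase h T { u with outp := v } := by
  funext y
  simp only [hBase, Function.update_apply]
  by_cases hy : y = (h .OUTP) <;> simp [hy]
/-- Writing a multiplier register of the base commutes. [folklore] -/
theorem update_hBase_g (y : GReg) : Function.update (hBase h T u) (h (.g y)) v = hBase h (Function.update T (h (.g y)) v) u := by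
  funext z
  by_cases hz : z = h (.g y)
  · subst hz; rw [Function.update_self, hBase_g, Function.update_self]
  · rw [Function.update_of_ne hz]; simp only [hBase, Function.update_apply, hz, if_false]

omit [DecidableEq β] in
/-- The multiplier's roles miss the machine's own registers. [folklore] -/
theorem rGH_ne (c : HReg) (hc : ∀ y, c ≠ .g y) : ∀ i, rGH h i ≠ h c := fun i e => hc i (h.injective e).symm

/-- A machine state is a multiplier state over the machine's base file. [folklore] -/
theorem hSt_eq_gSt : hSt h T u = gSt (rGH h) (hBase h T u) u.gw := rfl

/-- The base file does not depend on the multiplier's record. [folklore] -/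
@[simp] theorem hBase_with_gw (w : GSlots) : hBase h T { u with gw := w } = hBase h T u := rfl

/-- Back from a multiplier state over the machine's base file to a machine state. [folklore] -/
theorem gSt_hBase (w : GSlots) : gSt (rGH h) (hBase h T u) w = hSt h T { u with gw := w } := rfl

/-- Reading `X1`. [folklore] -/
@[simp] theorem hSt_X1 : hSt h T u (h .X1) = u.x1 := by
  rw [hSt, gSt_of_ne _ _ _ (rGH_ne h .X1 (fun _ e => HReg.noConfusion e)), hBase_X1]
/-- Writing `X1`. [folklore] -/
@[simp] theorem update_hSt_X1 : Function.update (hSt h T u) (h .X1) v = hSt h T { u with x1 := v } := by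
  rw [hSt, update_gSt_of_ne _ _ _ (rGH_ne h .X1 (fun _ e => HReg.noConfusion e)), update_hBase_X1]; rfl
/-- Reading `X2`. [folklore] -/
@[simp] theorem hSt_X2 : hSt h T u (h .X2) = u.x2 := by
  rw [hSt, gSt_of_ne _ _ _ (rGH_ne h .X2 (fun _ e => HReg.noConfusion e)), hBase_X2]
/-- Writing `X2`. [folklore] -/
@[simp] theorem update_hSt_X2 : Function.update (hSt h T u) (h .X2) v = hSt h T { u with x2 := v } := by
  rw [hSt, update_gSt_of_ne _ _ _ (rGH_ne h .X2 (fun _ e => HReg.noConfusion e)), update_hBase_X2]; rfl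
/-- Reading `X3`. [folklore] -/
@[simp] theorem hSt_X3 : hSt h T u (h .X3) = u.x3 := by
  rw [hSt, gSt_of_ne _ _ _ (rGH_ne h .X3 (fun _ e => HReg.noConfusion e)), hBase_X3]
/-- Writing `X3`. [folklore] -/
@[simp] theorem update_hSt_X3 : Function.update (hSt h T u) (h .X3) v = hSt h T { u with x3 := v } := by
  rw [hSt, update_gSt_of_ne _ _ _ (rGH_ne h .X3 (fun _ e => HReg.noConfusion e)), update_hBase_X3]; rfl
/-- Reading `X4`. [folklore] -/
@[simp] theorem hSt_X4 : hSt h T u (h .X4) = u.x4 := by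
  rw [hSt, gSt_of_ne _ _ _ (rGH_ne h .X4 (fun _ e => HReg.noConfusion e)), hBase_X4]
/-- Writing `X4`. [folklore] -/
@[simp] theorem update_hSt_X4 : Function.update (hSt h T u) (h .X4) v = hSt h T { u with x4 := v } := by
  rw [hSt, update_gSt_of_ne _ _ _ (rGH_ne h .X4 (fun _ e => HReg.noConfusion e)), update_hBase_X4]; rfl
/-- Reading `X5`. [folklore] -/
@[simp] theorem hSt_X5 : hSt h T u (h .X5) = u.x5 := by
  rw [hSt, gSt_of_ne _ _ _ (rGH_ne h .X5 (fun _ e => HReg.noConfusion e)), hBase_X5]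
/-- Writing `X5`. [folklore] -/
@[simp] theorem update_hSt_X5 : Function.update (hSt h T u) (h .X5) v = hSt h T { u with x5 := v } := by
  rw [hSt, update_gSt_of_ne _ _ _ (rGH_ne h .X5 (fun _ e => HReg.noConfusion e)), update_hBase_X5]; rfl
/-- Reading `X6`. [folklore] -/
@[simp] theorem hSt_X6 : hSt h T u (h .X6) = u.x6 := by
  rw [hSt, gSt_of_ne _ _ _ (rGH_ne h .X6 (fun _ e => HReg.noConfusion e)), hBase_X6]
/-- Writing `X6`. [folklore] -/
@[simp] theorem update_hSt_X6 : Function.update (hSt h T u) (h .X6) v = hSt h T { u with x6 := v } := by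
  rw [hSt, update_gSt_of_ne _ _ _ (rGH_ne h .X6 (fun _ e => HReg.noConfusion e)), update_hBase_X6]; rfl
/-- Reading `FL1`. [folklore] -/
@[simp] theorem hSt_FL1 : hSt h T u (h .FL1) = u.fl1 := by
  rw [hSt, gSt_of_ne _ _ _ (rGH_ne h .FL1 (fun _ e => HReg.noConfusion e)), hBase_FL1]
/-- Writing `FL1`. [folklore] -/
@[simp] theorem update_hSt_FL1 : Function.update (hSt h T u) (h .FL1) v = hSt h T { u with fl1 := v } := by
  rw [hSt, update_gSt_of_ne _ _ _ (rGH_ne h .FL1 (fun _ e => HReg.noConfusion e)), update_hBase_FL1]; rfl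
/-- Reading `FL2`. [folklore] -/
@[simp] theorem hSt_FL2 : hSt h T u (h .FL2) = u.fl2 := by
  rw [hSt, gSt_of_ne _ _ _ (rGH_ne h .FL2 (fun _ e => HReg.noConfusion e)), hBase_FL2]
/-- Writing `FL2`. [folklore] -/
@[simp] theorem update_hSt_FL2 : Function.update (hSt h T u) (h .FL2) v = hSt h T { u with fl2 := v } := by
  rw [hSt, update_gSt_of_ne _ _ _ (rGH_ne h .FL2 (fun _ e => HReg.noConfusion e)), update_hBase_FL2]; rfl
/-- Reading `U1`. [folklore] -/
@[simp] theorem hSt_U1 : hSt h T u (h .U1) = u.u1 := by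
  rw [hSt, gSt_of_ne _ _ _ (rGH_ne h .U1 (fun _ e => HReg.noConfusion e)), hBase_U1]
/-- Writing `U1`. [folklore] -/
@[simp] theorem update_hSt_U1 : Function.update (hSt h T u) (h .U1) v = hSt h T { u with u1 := v } := by
  rw [hSt, update_gSt_of_ne _ _ _ (rGH_ne h .U1 (fun _ e => HReg.noConfusion e)), update_hBase_U1]; rfl
/-- Reading `U2`. [folklore] -/
@[simp] theorem hSt_U2 : hSt h T u (h .U2) = u.u2 := by
  rw [hSt, gSt_of_ne _ _ _ (rGH_ne h .U2 (fun _ e => HReg.noConfusion e)), hBase_U2]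
/-- Writing `U2`. [folklore] -/
@[simp] theorem update_hSt_U2 : Function.update (hSt h T u) (h .U2) v = hSt h T { u with u2 := v } := by
  rw [hSt, update_gSt_of_ne _ _ _ (rGH_ne h .U2 (fun _ e => HReg.noConfusion e)), update_hBase_U2]; rfl
/-- Reading `L1`. [folklore] -/
@[simp] theorem hSt_L1 : hSt h T u (h .L1) = u.l1 := by
  rw [hSt, gSt_of_ne _ _ _ (rGH_ne h .L1 (fun _ e => HReg.noConfusion e)), hBase_L1]
/-- Writing `L1`. [folklore] -/
@[simp] theorem update_hSt_L1 : Function.update (hSt h T u) (h .L1) v = hSt h T { u with l1 := v } := by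
  rw [hSt, update_gSt_of_ne _ _ _ (rGH_ne h .L1 (fun _ e => HReg.noConfusion e)), update_hBase_L1]; rfl
/-- Reading `L2`. [folklore] -/
@[simp] theorem hSt_L2 : hSt h T u (h .L2) = u.l2 := by
  rw [hSt, gSt_of_ne _ _ _ (rGH_ne h .L2 (fun _ e => HReg.noConfusion e)), hBase_L2]
/-- Writing `L2`. [folklore] -/
@[simp] theorem update_hSt_L2 : Function.update (hSt h T u) (h .L2) v = hSt h T { u with l2 := v } := by
  rw [hSt, update_gSt_of_ne _ _ _ (rGH_ne h .L2 (fun _ e => HReg.noConfusion e)), update_hBase_L2]; rfl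
/-- Reading `L3`. [folklore] -/
@[simp] theorem hSt_L3 : hSt h T u (h .L3) = u.l3 := by
  rw [hSt, gSt_of_ne _ _ _ (rGH_ne h .L3 (fun _ e => HReg.noConfusion e)), hBase_L3]
/-- Writing `L3`. [folklore] -/
@[simp] theorem update_hSt_L3 : Function.update (hSt h T u) (h .L3) v = hSt h T { u with l3 := v } := by
  rw [hSt, update_gSt_of_ne _ _ _ (rGH_ne h .L3 (fun _ e => HReg.noConfusion e)), update_hBase_L3]; rfl
/-- Reading `L4`. [folklore] -/
@[simp] theorem hSt_L4 : hSt h T u (h .L4) = u.l4 := by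
  rw [hSt, gSt_of_ne _ _ _ (rGH_ne h .L4 (fun _ e => HReg.noConfusion e)), hBase_L4]
/-- Writing `L4`. [folklore] -/
@[simp] theorem update_hSt_L4 : Function.update (hSt h T u) (h .L4) v = hSt h T { u with l4 := v } := by
  rw [hSt, update_gSt_of_ne _ _ _ (rGH_ne h .L4 (fun _ e => HReg.noConfusion e)), update_hBase_L4]; rfl
/-- Reading `SQ1`. [folklore] -/
@[simp] theorem hSt_SQ1 : hSt h T u (h .SQ1) = u.sq1 := by
  rw [hSt, gSt_of_ne _ _ _ (rGH_ne h .SQ1 (fun _ e => HReg.noConfusion e)), hBase_SQ1]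
/-- Writing `SQ1`. [folklore] -/
@[simp] theorem update_hSt_SQ1 : Function.update (hSt h T u) (h .SQ1) v = hSt h T { u with sq1 := v } := by
  rw [hSt, update_gSt_of_ne _ _ _ (rGH_ne h .SQ1 (fun _ e => HReg.noConfusion e)), update_hBase_SQ1]; rfl
/-- Reading `SQ2`. [folklore] -/
@[simp] theorem hSt_SQ2 : hSt h T u (h .SQ2) = u.sq2 := by
  rw [hSt, gSt_of_ne _ _ _ (rGH_ne h .SQ2 (fun _ e => HReg.noConfusion e)), hBase_SQ2]
/-- Writing `SQ2`. [folklore] -/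
@[simp] theorem update_hSt_SQ2 : Function.update (hSt h T u) (h .SQ2) v = hSt h T { u with sq2 := v } := by
  rw [hSt, update_gSt_of_ne _ _ _ (rGH_ne h .SQ2 (fun _ e => HReg.noConfusion e)), update_hBase_SQ2]; rfl
/-- Reading `SQ3`. [folklore] -/
@[simp] theorem hSt_SQ3 : hSt h T u (h .SQ3) = u.sq3 := by
  rw [hSt, gSt_of_ne _ _ _ (rGH_ne h .SQ3 (fun _ e => HReg.noConfusion e)), hBase_SQ3]
/-- Writing `SQ3`. [folklore] -/
@[simp] theorem update_hSt_SQ3 : Function.update (hSt h T u) (h .SQ3) v = hSt h T { u with sq3 := v } := by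
  rw [hSt, update_gSt_of_ne _ _ _ (rGH_ne h .SQ3 (fun _ e => HReg.noConfusion e)), update_hBase_SQ3]; rfl
/-- Reading `SQ4`. [folklore] -/
@[simp] theorem hSt_SQ4 : hSt h T u (h .SQ4) = u.sq4 := by
  rw [hSt, gSt_of_ne _ _ _ (rGH_ne h .SQ4 (fun _ e => HReg.noConfusion e)), hBase_SQ4]
/-- Writing `SQ4`. [folklore] -/
@[simp] theorem update_hSt_SQ4 : Function.update (hSt h T u) (h .SQ4) v = hSt h T { u with sq4 := v } := by
  rw [hSt, update_gSt_of_ne _ _ _ (rGH_ne h .SQ4 (fun _ e => HReg.noConfusion e)), update_hBase_SQ4]; rfl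
/-- Reading `SQ5`. [folklore] -/
@[simp] theorem hSt_SQ5 : hSt h T u (h .SQ5) = u.sq5 := by
  rw [hSt, gSt_of_ne _ _ _ (rGH_ne h .SQ5 (fun _ e => HReg.noConfusion e)), hBase_SQ5]
/-- Writing `SQ5`. [folklore] -/
@[simp] theorem update_hSt_SQ5 : Function.update (hSt h T u) (h .SQ5) v = hSt h T { u with sq5 := v } := by
  rw [hSt, update_gSt_of_ne _ _ _ (rGH_ne h .SQ5 (fun _ e => HReg.noConfusion e)), update_hBase_SQ5]; rfl
/-- Reading `RX1`. [folklore] -/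
@[simp] theorem hSt_RX1 : hSt h T u (h .RX1) = u.rx1 := by
  rw [hSt, gSt_of_ne _ _ _ (rGH_ne h .RX1 (fun _ e => HReg.noConfusion e)), hBase_RX1]
/-- Writing `RX1`. [folklore] -/
@[simp] theorem update_hSt_RX1 : Function.update (hSt h T u) (h .RX1) v = hSt h T { u with rx1 := v } := by
  rw [hSt, update_gSt_of_ne _ _ _ (rGH_ne h .RX1 (fun _ e => HReg.noConfusion e)), update_hBase_RX1]; rfl
/-- Reading `RX2`. [folklore] -/
@[simp] theorem hSt_RX2 : hSt h T u (h .RX2) = u.rx2 := by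
  rw [hSt, gSt_of_ne _ _ _ (rGH_ne h .RX2 (fun _ e => HReg.noConfusion e)), hBase_RX2]
/-- Writing `RX2`. [folklore] -/
@[simp] theorem update_hSt_RX2 : Function.update (hSt h T u) (h .RX2) v = hSt h T { u with rx2 := v } := by
  rw [hSt, update_gSt_of_ne _ _ _ (rGH_ne h .RX2 (fun _ e => HReg.noConfusion e)), update_hBase_RX2]; rfl
/-- Reading `RX3`. [folklore] -/
@[simp] theorem hSt_RX3 : hSt h T u (h .RX3) = u.rx3 := by
  rw [hSt, gSt_of_ne _ _ _ (rGH_ne h .RX3 (fun _ e => HReg.noConfusion e)), hBase_RX3]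
/-- Writing `RX3`. [folklore] -/
@[simp] theorem update_hSt_RX3 : Function.update (hSt h T u) (h .RX3) v = hSt h T { u with rx3 := v } := by
  rw [hSt, update_gSt_of_ne _ _ _ (rGH_ne h .RX3 (fun _ e => HReg.noConfusion e)), update_hBase_RX3]; rfl
/-- Reading `RX4`. [folklore] -/
@[simp] theorem hSt_RX4 : hSt h T u (h .RX4) = u.rx4 := by
  rw [hSt, gSt_of_ne _ _ _ (rGH_ne h .RX4 (fun _ e => HReg.noConfusion e)), hBase_RX4]
/-- Writing `RX4`. [folklore] -/
@[simp] theorem update_hSt_RX4 : Function.update (hSt h T u) (h .RX4) v = hSt h T { u with rx4 := v } := by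
  rw [hSt, update_gSt_of_ne _ _ _ (rGH_ne h .RX4 (fun _ e => HReg.noConfusion e)), update_hBase_RX4]; rfl
/-- Reading `RX5`. [folklore] -/
@[simp] theorem hSt_RX5 : hSt h T u (h .RX5) = u.rx5 := by
  rw [hSt, gSt_of_ne _ _ _ (rGH_ne h .RX5 (fun _ e => HReg.noConfusion e)), hBase_RX5]
/-- Writing `RX5`. [folklore] -/
@[simp] theorem update_hSt_RX5 : Function.update (hSt h T u) (h .RX5) v = hSt h T { u with rx5 := v } := by
  rw [hSt, update_gSt_of_ne _ _ _ (rGH_ne h .RX5 (fun _ e => HReg.noConfusion e)), update_hBase_RX5]; rfl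
/-- Reading `RX6`. [folklore] -/
@[simp] theorem hSt_RX6 : hSt h T u (h .RX6) = u.rx6 := by
  rw [hSt, gSt_of_ne _ _ _ (rGH_ne h .RX6 (fun _ e => HReg.noConfusion e)), hBase_RX6]
/-- Writing `RX6`. [folklore] -/
@[simp] theorem update_hSt_RX6 : Function.update (hSt h T u) (h .RX6) v = hSt h T { u with rx6 := v } := by
  rw [hSt, update_gSt_of_ne _ _ _ (rGH_ne h .RX6 (fun _ e => HReg.noConfusion e)), update_hBase_RX6]; rfl
/-- Reading `RX7`. [folklore] -/
@[simp] theorem hSt_RX7 : hSt h T u (h .RX7) = u.rx7 := by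
  rw [hSt, gSt_of_ne _ _ _ (rGH_ne h .RX7 (fun _ e => HReg.noConfusion e)), hBase_RX7]
/-- Writing `RX7`. [folklore] -/
@[simp] theorem update_hSt_RX7 : Function.update (hSt h T u) (h .RX7) v = hSt h T { u with rx7 := v } := by
  rw [hSt, update_gSt_of_ne _ _ _ (rGH_ne h .RX7 (fun _ e => HReg.noConfusion e)), update_hBase_RX7]; rfl
/-- Reading `RX8`. [folklore] -/
@[simp] theorem hSt_RX8 : hSt h T u (h .RX8) = u.rx8 := by
  rw [hSt, gSt_of_ne _ _ _ (rGH_ne h .RX8 (fun _ e => HReg.noConfusion e)), hBase_RX8]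
/-- Writing `RX8`. [folklore] -/
@[simp] theorem update_hSt_RX8 : Function.update (hSt h T u) (h .RX8) v = hSt h T { u with rx8 := v } := by
  rw [hSt, update_gSt_of_ne _ _ _ (rGH_ne h .RX8 (fun _ e => HReg.noConfusion e)), update_hBase_RX8]; rfl
/-- Reading `RX9`. [folklore] -/
@[simp] theorem hSt_RX9 : hSt h T u (h .RX9) = u.rx9 := by
  rw [hSt, gSt_of_ne _ _ _ (rGH_ne h .RX9 (fun _ e => HReg.noConfusion e)), hBase_RX9]
/-- Writing `RX9`. [folklore] -/
@[simp] theorem update_hSt_RX9 : Function.update (hSt h T u) (h .RX9) v = hSt h T { u with rx9 := v } := by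
  rw [hSt, update_gSt_of_ne _ _ _ (rGH_ne h .RX9 (fun _ e => HReg.noConfusion e)), update_hBase_RX9]; rfl
/-- Reading `PTK`. [folklore] -/
@[simp] theorem hSt_PTK : hSt h T u (h .PTK) = u.ptk := by
  rw [hSt, gSt_of_ne _ _ _ (rGH_ne h .PTK (fun _ e => HReg.noConfusion e)), hBase_PTK]
/-- Writing `PTK`. [folklore] -/
@[simp] theorem update_hSt_PTK : Function.update (hSt h T u) (h .PTK) v = hSt h T { u with ptk := v } := by
  rw [hSt, update_gSt_of_ne _ _ _ (rGH_ne h .PTK (fun _ e => HReg.noConfusion e)), update_hBase_PTK]; rfl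
/-- Reading `PTU`. [folklore] -/
@[simp] theorem hSt_PTU : hSt h T u (h .PTU) = u.ptu := by
  rw [hSt, gSt_of_ne _ _ _ (rGH_ne h .PTU (fun _ e => HReg.noConfusion e)), hBase_PTU]
/-- Writing `PTU`. [folklore] -/
@[simp] theorem update_hSt_PTU : Function.update (hSt h T u) (h .PTU) v = hSt h T { u with ptu := v } := by
  rw [hSt, update_gSt_of_ne _ _ _ (rGH_ne h .PTU (fun _ e => HReg.noConfusion e)), update_hBase_PTU]; rfl
/-- Reading `BLF`. [folklore] -/
@[simp] theorem hSt_BLF : hSt h T u (h .BLF) = u.blf := by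
  rw [hSt, gSt_of_ne _ _ _ (rGH_ne h .BLF (fun _ e => HReg.noConfusion e)), hBase_BLF]
/-- Writing `BLF`. [folklore] -/
@[simp] theorem update_hSt_BLF : Function.update (hSt h T u) (h .BLF) v = hSt h T { u with blf := v } := by
  rw [hSt, update_gSt_of_ne _ _ _ (rGH_ne h .BLF (fun _ e => HReg.noConfusion e)), update_hBase_BLF]; rfl
/-- Reading `BLA`. [folklore] -/
@[simp] theorem hSt_BLA : hSt h T u (h .BLA) = u.bla := by
  rw [hSt, gSt_of_ne _ _ _ (rGH_ne h .BLA (fun _ e => HReg.noConfusion e)), hBase_BLA]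
/-- Writing `BLA`. [folklore] -/
@[simp] theorem update_hSt_BLA : Function.update (hSt h T u) (h .BLA) v = hSt h T { u with bla := v } := by
  rw [hSt, update_gSt_of_ne _ _ _ (rGH_ne h .BLA (fun _ e => HReg.noConfusion e)), update_hBase_BLA]; rfl
/-- Reading `BLM`. [folklore] -/
@[simp] theorem hSt_BLM : hSt h T u (h .BLM) = u.blm := by
  rw [hSt, gSt_of_ne _ _ _ (rGH_ne h .BLM (fun _ e => HReg.noConfusion e)), hBase_BLM]
/-- Writing `BLM`. [folklore] -/
@[simp] theorem update_hSt_BLM : Function.update (hSt h T u) (h .BLM) v = hSt h T { u with blm := v } := by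
  rw [hSt, update_gSt_of_ne _ _ _ (rGH_ne h .BLM (fun _ e => HReg.noConfusion e)), update_hBase_BLM]; rfl
/-- Reading `BLMU`. [folklore] -/
@[simp] theorem hSt_BLMU : hSt h T u (h .BLMU) = u.blmu := by
  rw [hSt, gSt_of_ne _ _ _ (rGH_ne h .BLMU (fun _ e => HReg.noConfusion e)), hBase_BLMU]
/-- Writing `BLMU`. [folklore] -/
@[simp] theorem update_hSt_BLMU : Function.update (hSt h T u) (h .BLMU) v = hSt h T { u with blmu := v } := by
  rw [hSt, update_gSt_of_ne _ _ _ (rGH_ne h .BLMU (fun _ e => HReg.noConfusion e)), update_hBase_BLMU]; rfl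
/-- Reading `BLE`. [folklore] -/
@[simp] theorem hSt_BLE : hSt h T u (h .BLE) = u.ble := by
  rw [hSt, gSt_of_ne _ _ _ (rGH_ne h .BLE (fun _ e => HReg.noConfusion e)), hBase_BLE]
/-- Writing `BLE`. [folklore] -/
@[simp] theorem update_hSt_BLE : Function.update (hSt h T u) (h .BLE) v = hSt h T { u with ble := v } := by
  rw [hSt, update_gSt_of_ne _ _ _ (rGH_ne h .BLE (fun _ e => HReg.noConfusion e)), update_hBase_BLE]; rfl
/-- Reading `BLPOW`. [folklore] -/
@[simp] theorem hSt_BLPOW : hSt h T u (h .BLPOW) = u.blpow := by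
  rw [hSt, gSt_of_ne _ _ _ (rGH_ne h .BLPOW (fun _ e => HReg.noConfusion e)), hBase_BLPOW]
/-- Writing `BLPOW`. [folklore] -/
@[simp] theorem update_hSt_BLPOW : Function.update (hSt h T u) (h .BLPOW) v = hSt h T { u with blpow := v } := by
  rw [hSt, update_gSt_of_ne _ _ _ (rGH_ne h .BLPOW (fun _ e => HReg.noConfusion e)), update_hBase_BLPOW]; rfl
/-- Reading `BLC1`. [folklore] -/
@[simp] theorem hSt_BLC1 : hSt h T u (h .BLC1) = u.blc1 := by
  rw [hSt, gSt_of_ne _ _ _ (rGH_ne h .BLC1 (fun _ e => HReg.noConfusion e)), hBase_BLC1]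
/-- Writing `BLC1`. [folklore] -/
@[simp] theorem update_hSt_BLC1 : Function.update (hSt h T u) (h .BLC1) v = hSt h T { u with blc1 := v } := by
  rw [hSt, update_gSt_of_ne _ _ _ (rGH_ne h .BLC1 (fun _ e => HReg.noConfusion e)), update_hBase_BLC1]; rfl
/-- Reading `BLC2`. [folklore] -/
@[simp] theorem hSt_BLC2 : hSt h T u (h .BLC2) = u.blc2 := by
  rw [hSt, gSt_of_ne _ _ _ (rGH_ne h .BLC2 (fun _ e => HReg.noConfusion e)), hBase_BLC2]
/-- Writing `BLC2`. [folklore] -/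
@[simp] theorem update_hSt_BLC2 : Function.update (hSt h T u) (h .BLC2) v = hSt h T { u with blc2 := v } := by
  rw [hSt, update_gSt_of_ne _ _ _ (rGH_ne h .BLC2 (fun _ e => HReg.noConfusion e)), update_hBase_BLC2]; rfl
/-- Reading `BLFP`. [folklore] -/
@[simp] theorem hSt_BLFP : hSt h T u (h .BLFP) = u.blfp := by
  rw [hSt, gSt_of_ne _ _ _ (rGH_ne h .BLFP (fun _ e => HReg.noConfusion e)), hBase_BLFP]
/-- Writing `BLFP`. [folklore] -/
@[simp] theorem update_hSt_BLFP : Function.update (hSt h T u) (h .BLFP) v = hSt h T { u with blfp := v } := by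
  rw [hSt, update_gSt_of_ne _ _ _ (rGH_ne h .BLFP (fun _ e => HReg.noConfusion e)), update_hBase_BLFP]; rfl
/-- Reading `BLG`. [folklore] -/
@[simp] theorem hSt_BLG : hSt h T u (h .BLG) = u.blg := by
  rw [hSt, gSt_of_ne _ _ _ (rGH_ne h .BLG (fun _ e => HReg.noConfusion e)), hBase_BLG]
/-- Writing `BLG`. [folklore] -/
@[simp] theorem update_hSt_BLG : Function.update (hSt h T u) (h .BLG) v = hSt h T { u with blg := v } := by
  rw [hSt, update_gSt_of_ne _ _ _ (rGH_ne h .BLG (fun _ e => HReg.noConfusion e)), update_hBase_BLG]; rfl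
/-- Reading `BLOUT`. [folklore] -/
@[simp] theorem hSt_BLOUT : hSt h T u (h .BLOUT) = u.blout := by
  rw [hSt, gSt_of_ne _ _ _ (rGH_ne h .BLOUT (fun _ e => HReg.noConfusion e)), hBase_BLOUT]
/-- Writing `BLOUT`. [folklore] -/
@[simp] theorem update_hSt_BLOUT : Function.update (hSt h T u) (h .BLOUT) v = hSt h T { u with blout := v } := by
  rw [hSt, update_gSt_of_ne _ _ _ (rGH_ne h .BLOUT (fun _ e => HReg.noConfusion e)), update_hBase_BLOUT]; rfl
/-- Reading `BLK`. [folklore] -/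
@[simp] theorem hSt_BLK : hSt h T u (h .BLK) = u.blk := by
  rw [hSt, gSt_of_ne _ _ _ (rGH_ne h .BLK (fun _ e => HReg.noConfusion e)), hBase_BLK]
/-- Writing `BLK`. [folklore] -/
@[simp] theorem update_hSt_BLK : Function.update (hSt h T u) (h .BLK) v = hSt h T { u with blk := v } := by
  rw [hSt, update_gSt_of_ne _ _ _ (rGH_ne h .BLK (fun _ e => HReg.noConfusion e)), update_hBase_BLK]; rfl
/-- Reading `A1V`. [folklore] -/
@[simp] theorem hSt_A1V : hSt h T u (h .A1V) = u.a1v := by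
  rw [hSt, gSt_of_ne _ _ _ (rGH_ne h .A1V (fun _ e => HReg.noConfusion e)), hBase_A1V]
/-- Writing `A1V`. [folklore] -/
@[simp] theorem update_hSt_A1V : Function.update (hSt h T u) (h .A1V) v = hSt h T { u with a1v := v } := by
  rw [hSt, update_gSt_of_ne _ _ _ (rGH_ne h .A1V (fun _ e => HReg.noConfusion e)), update_hBase_A1V]; rfl
/-- Reading `A1I`. [folklore] -/
@[simp] theorem hSt_A1I : hSt h T u (h .A1I) = u.a1i := by
  rw [hSt, gSt_of_ne _ _ _ (rGH_ne h .A1I (fun _ e => HReg.noConfusion e)), hBase_A1I]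
/-- Writing `A1I`. [folklore] -/
@[simp] theorem update_hSt_A1I : Function.update (hSt h T u) (h .A1I) v = hSt h T { u with a1i := v } := by
  rw [hSt, update_gSt_of_ne _ _ _ (rGH_ne h .A1I (fun _ e => HReg.noConfusion e)), update_hBase_A1I]; rfl
/-- Reading `A1AI`. [folklore] -/
@[simp] theorem hSt_A1AI : hSt h T u (h .A1AI) = u.a1ai := by
  rw [hSt, gSt_of_ne _ _ _ (rGH_ne h .A1AI (fun _ e => HReg.noConfusion e)), hBase_A1AI]
/-- Writing `A1AI`. [folklore] -/
@[simp] theorem update_hSt_A1AI : Function.update (hSt h T u) (h .A1AI) v = hSt h T { u with a1ai := v } := by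
  rw [hSt, update_gSt_of_ne _ _ _ (rGH_ne h .A1AI (fun _ e => HReg.noConfusion e)), update_hBase_A1AI]; rfl
/-- Reading `A1G`. [folklore] -/
@[simp] theorem hSt_A1G : hSt h T u (h .A1G) = u.a1g := by
  rw [hSt, gSt_of_ne _ _ _ (rGH_ne h .A1G (fun _ e => HReg.noConfusion e)), hBase_A1G]
/-- Writing `A1G`. [folklore] -/
@[simp] theorem update_hSt_A1G : Function.update (hSt h T u) (h .A1G) v = hSt h T { u with a1g := v } := by
  rw [hSt, update_gSt_of_ne _ _ _ (rGH_ne h .A1G (fun _ e => HReg.noConfusion e)), update_hBase_A1G]; rfl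
/-- Reading `A1P`. [folklore] -/
@[simp] theorem hSt_A1P : hSt h T u (h .A1P) = u.a1p := by
  rw [hSt, gSt_of_ne _ _ _ (rGH_ne h .A1P (fun _ e => HReg.noConfusion e)), hBase_A1P]
/-- Writing `A1P`. [folklore] -/
@[simp] theorem update_hSt_A1P : Function.update (hSt h T u) (h .A1P) v = hSt h T { u with a1p := v } := by
  rw [hSt, update_gSt_of_ne _ _ _ (rGH_ne h .A1P (fun _ e => HReg.noConfusion e)), update_hBase_A1P]; rfl
/-- Reading `A1C`. [folklore] -/
@[simp] theorem hSt_A1C : hSt h T u (h .A1C) = u.a1c := by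
  rw [hSt, gSt_of_ne _ _ _ (rGH_ne h .A1C (fun _ e => HReg.noConfusion e)), hBase_A1C]
/-- Writing `A1C`. [folklore] -/
@[simp] theorem update_hSt_A1C : Function.update (hSt h T u) (h .A1C) v = hSt h T { u with a1c := v } := by
  rw [hSt, update_gSt_of_ne _ _ _ (rGH_ne h .A1C (fun _ e => HReg.noConfusion e)), update_hBase_A1C]; rfl
/-- Reading `A2R`. [folklore] -/
@[simp] theorem hSt_A2R : hSt h T u (h .A2R) = u.a2r := by
  rw [hSt, gSt_of_ne _ _ _ (rGH_ne h .A2R (fun _ e => HReg.noConfusion e)), hBase_A2R]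
/-- Writing `A2R`. [folklore] -/
@[simp] theorem update_hSt_A2R : Function.update (hSt h T u) (h .A2R) v = hSt h T { u with a2r := v } := by
  rw [hSt, update_gSt_of_ne _ _ _ (rGH_ne h .A2R (fun _ e => HReg.noConfusion e)), update_hBase_A2R]; rfl
/-- Reading `A2M`. [folklore] -/
@[simp] theorem hSt_A2M : hSt h T u (h .A2M) = u.a2m := by
  rw [hSt, gSt_of_ne _ _ _ (rGH_ne h .A2M (fun _ e => HReg.noConfusion e)), hBase_A2M]
/-- Writing `A2M`. [folklore] -/
@[simp] theorem update_hSt_A2M : Function.update (hSt h T u) (h .A2M) v = hSt h T { u with a2m := v } := by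
  rw [hSt, update_gSt_of_ne _ _ _ (rGH_ne h .A2M (fun _ e => HReg.noConfusion e)), update_hBase_A2M]; rfl
/-- Reading `A2AL`. [folklore] -/
@[simp] theorem hSt_A2AL : hSt h T u (h .A2AL) = u.a2al := by
  rw [hSt, gSt_of_ne _ _ _ (rGH_ne h .A2AL (fun _ e => HReg.noConfusion e)), hBase_A2AL]
/-- Writing `A2AL`. [folklore] -/
@[simp] theorem update_hSt_A2AL : Function.update (hSt h T u) (h .A2AL) v = hSt h T { u with a2al := v } := by
  rw [hSt, update_gSt_of_ne _ _ _ (rGH_ne h .A2AL (fun _ e => HReg.noConfusion e)), update_hBase_A2AL]; rfl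
/-- Reading `A2AM`. [folklore] -/
@[simp] theorem hSt_A2AM : hSt h T u (h .A2AM) = u.a2am := by
  rw [hSt, gSt_of_ne _ _ _ (rGH_ne h .A2AM (fun _ e => HReg.noConfusion e)), hBase_A2AM]
/-- Writing `A2AM`. [folklore] -/
@[simp] theorem update_hSt_A2AM : Function.update (hSt h T u) (h .A2AM) v = hSt h T { u with a2am := v } := by
  rw [hSt, update_gSt_of_ne _ _ _ (rGH_ne h .A2AM (fun _ e => HReg.noConfusion e)), update_hBase_A2AM]; rfl
/-- Reading `A2C`. [folklore] -/
@[simp] theorem hSt_A2C : hSt h T u (h .A2C) = u.a2c := by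
  rw [hSt, gSt_of_ne _ _ _ (rGH_ne h .A2C (fun _ e => HReg.noConfusion e)), hBase_A2C]
/-- Writing `A2C`. [folklore] -/
@[simp] theorem update_hSt_A2C : Function.update (hSt h T u) (h .A2C) v = hSt h T { u with a2c := v } := by
  rw [hSt, update_gSt_of_ne _ _ _ (rGH_ne h .A2C (fun _ e => HReg.noConfusion e)), update_hBase_A2C]; rfl
/-- Reading `A2J`. [folklore] -/
@[simp] theorem hSt_A2J : hSt h T u (h .A2J) = u.a2j := by
  rw [hSt, gSt_of_ne _ _ _ (rGH_ne h .A2J (fun _ e => HReg.noConfusion e)), hBase_A2J]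
/-- Writing `A2J`. [folklore] -/
@[simp] theorem update_hSt_A2J : Function.update (hSt h T u) (h .A2J) v = hSt h T { u with a2j := v } := by
  rw [hSt, update_gSt_of_ne _ _ _ (rGH_ne h .A2J (fun _ e => HReg.noConfusion e)), update_hBase_A2J]; rfl
/-- Reading `A2A`. [folklore] -/
@[simp] theorem hSt_A2A : hSt h T u (h .A2A) = u.a2a := by
  rw [hSt, gSt_of_ne _ _ _ (rGH_ne h .A2A (fun _ e => HReg.noConfusion e)), hBase_A2A]
/-- Writing `A2A`. [folklore] -/
@[simp] theorem update_hSt_A2A : Function.update (hSt h T u) (h .A2A) v = hSt h T { u with a2a := v } := by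
  rw [hSt, update_gSt_of_ne _ _ _ (rGH_ne h .A2A (fun _ e => HReg.noConfusion e)), update_hBase_A2A]; rfl
/-- Reading `A2B`. [folklore] -/
@[simp] theorem hSt_A2B : hSt h T u (h .A2B) = u.a2b := by
  rw [hSt, gSt_of_ne _ _ _ (rGH_ne h .A2B (fun _ e => HReg.noConfusion e)), hBase_A2B]
/-- Writing `A2B`. [folklore] -/
@[simp] theorem update_hSt_A2B : Function.update (hSt h T u) (h .A2B) v = hSt h T { u with a2b := v } := by
  rw [hSt, update_gSt_of_ne _ _ _ (rGH_ne h .A2B (fun _ e => HReg.noConfusion e)), update_hBase_A2B]; rfl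
/-- Reading `A2JJ`. [folklore] -/
@[simp] theorem hSt_A2JJ : hSt h T u (h .A2JJ) = u.a2jj := by
  rw [hSt, gSt_of_ne _ _ _ (rGH_ne h .A2JJ (fun _ e => HReg.noConfusion e)), hBase_A2JJ]
/-- Writing `A2JJ`. [folklore] -/
@[simp] theorem update_hSt_A2JJ : Function.update (hSt h T u) (h .A2JJ) v = hSt h T { u with a2jj := v } := by
  rw [hSt, update_gSt_of_ne _ _ _ (rGH_ne h .A2JJ (fun _ e => HReg.noConfusion e)), update_hBase_A2JJ]; rfl
/-- Reading `A2T`. [folklore] -/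
@[simp] theorem hSt_A2T : hSt h T u (h .A2T) = u.a2t := by
  rw [hSt, gSt_of_ne _ _ _ (rGH_ne h .A2T (fun _ e => HReg.noConfusion e)), hBase_A2T]
/-- Writing `A2T`. [folklore] -/
@[simp] theorem update_hSt_A2T : Function.update (hSt h T u) (h .A2T) v = hSt h T { u with a2t := v } := by
  rw [hSt, update_gSt_of_ne _ _ _ (rGH_ne h .A2T (fun _ e => HReg.noConfusion e)), update_hBase_A2T]; rfl
/-- Reading `A2V`. [folklore] -/
@[simp] theorem hSt_A2V : hSt h T u (h .A2V) = u.a2v := by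
  rw [hSt, gSt_of_ne _ _ _ (rGH_ne h .A2V (fun _ e => HReg.noConfusion e)), hBase_A2V]
/-- Writing `A2V`. [folklore] -/
@[simp] theorem update_hSt_A2V : Function.update (hSt h T u) (h .A2V) v = hSt h T { u with a2v := v } := by
  rw [hSt, update_gSt_of_ne _ _ _ (rGH_ne h .A2V (fun _ e => HReg.noConfusion e)), update_hBase_A2V]; rfl
/-- Reading `A2S`. [folklore] -/
@[simp] theorem hSt_A2S : hSt h T u (h .A2S) = u.a2s := by
  rw [hSt, gSt_of_ne _ _ _ (rGH_ne h .A2S (fun _ e => HReg.noConfusion e)), hBase_A2S]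
/-- Writing `A2S`. [folklore] -/
@[simp] theorem update_hSt_A2S : Function.update (hSt h T u) (h .A2S) v = hSt h T { u with a2s := v } := by
  rw [hSt, update_gSt_of_ne _ _ _ (rGH_ne h .A2S (fun _ e => HReg.noConfusion e)), update_hBase_A2S]; rfl
/-- Reading `A2L1`. [folklore] -/
@[simp] theorem hSt_A2L1 : hSt h T u (h .A2L1) = u.a2l1 := by
  rw [hSt, gSt_of_ne _ _ _ (rGH_ne h .A2L1 (fun _ e => HReg.noConfusion e)), hBase_A2L1]
/-- Writing `A2L1`. [folklore] -/
@[simp] theorem update_hSt_A2L1 : Function.update (hSt h T u) (h .A2L1) v = hSt h T { u with a2l1 := v } := by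
  rw [hSt, update_gSt_of_ne _ _ _ (rGH_ne h .A2L1 (fun _ e => HReg.noConfusion e)), update_hBase_A2L1]; rfl
/-- Reading `A2L2`. [folklore] -/
@[simp] theorem hSt_A2L2 : hSt h T u (h .A2L2) = u.a2l2 := by
  rw [hSt, gSt_of_ne _ _ _ (rGH_ne h .A2L2 (fun _ e => HReg.noConfusion e)), hBase_A2L2]
/-- Writing `A2L2`. [folklore] -/
@[simp] theorem update_hSt_A2L2 : Function.update (hSt h T u) (h .A2L2) v = hSt h T { u with a2l2 := v } := by
  rw [hSt, update_gSt_of_ne _ _ _ (rGH_ne h .A2L2 (fun _ e => HReg.noConfusion e)), update_hBase_A2L2]; rfl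
/-- Reading `A2SRT`. [folklore] -/
@[simp] theorem hSt_A2SRT : hSt h T u (h .A2SRT) = u.a2srt := by
  rw [hSt, gSt_of_ne _ _ _ (rGH_ne h .A2SRT (fun _ e => HReg.noConfusion e)), hBase_A2SRT]
/-- Writing `A2SRT`. [folklore] -/
@[simp] theorem update_hSt_A2SRT : Function.update (hSt h T u) (h .A2SRT) v = hSt h T { u with a2srt := v } := by
  rw [hSt, update_gSt_of_ne _ _ _ (rGH_ne h .A2SRT (fun _ e => HReg.noConfusion e)), update_hBase_A2SRT]; rfl
/-- Reading `A2U`. [folklore] -/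
@[simp] theorem hSt_A2U : hSt h T u (h .A2U) = u.a2u := by
  rw [hSt, gSt_of_ne _ _ _ (rGH_ne h .A2U (fun _ e => HReg.noConfusion e)), hBase_A2U]
/-- Writing `A2U`. [folklore] -/
@[simp] theorem update_hSt_A2U : Function.update (hSt h T u) (h .A2U) v = hSt h T { u with a2u := v } := by
  rw [hSt, update_gSt_of_ne _ _ _ (rGH_ne h .A2U (fun _ e => HReg.noConfusion e)), update_hBase_A2U]; rfl
/-- Reading `A2D`. [folklore] -/
@[simp] theorem hSt_A2D : hSt h T u (h .A2D) = u.a2d := by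
  rw [hSt, gSt_of_ne _ _ _ (rGH_ne h .A2D (fun _ e => HReg.noConfusion e)), hBase_A2D]
/-- Writing `A2D`. [folklore] -/
@[simp] theorem update_hSt_A2D : Function.update (hSt h T u) (h .A2D) v = hSt h T { u with a2d := v } := by
  rw [hSt, update_gSt_of_ne _ _ _ (rGH_ne h .A2D (fun _ e => HReg.noConfusion e)), update_hBase_A2D]; rfl
/-- Reading `A2Y`. [folklore] -/
@[simp] theorem hSt_A2Y : hSt h T u (h .A2Y) = u.a2y := by
  rw [hSt, gSt_of_ne _ _ _ (rGH_ne h .A2Y (fun _ e => HReg.noConfusion e)), hBase_A2Y]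
/-- Writing `A2Y`. [folklore] -/
@[simp] theorem update_hSt_A2Y : Function.update (hSt h T u) (h .A2Y) v = hSt h T { u with a2y := v } := by
  rw [hSt, update_gSt_of_ne _ _ _ (rGH_ne h .A2Y (fun _ e => HReg.noConfusion e)), update_hBase_A2Y]; rfl
/-- Reading `A2P`. [folklore] -/
@[simp] theorem hSt_A2P : hSt h T u (h .A2P) = u.a2p := by
  rw [hSt, gSt_of_ne _ _ _ (rGH_ne h .A2P (fun _ e => HReg.noConfusion e)), hBase_A2P]
/-- Writing `A2P`. [folklore] -/
@[simp] theorem update_hSt_A2P : Function.update (hSt h T u) (h .A2P) v = hSt h T { u with a2p := v } := by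
  rw [hSt, update_gSt_of_ne _ _ _ (rGH_ne h .A2P (fun _ e => HReg.noConfusion e)), update_hBase_A2P]; rfl
/-- Reading `A2Q`. [folklore] -/
@[simp] theorem hSt_A2Q : hSt h T u (h .A2Q) = u.a2q := by
  rw [hSt, gSt_of_ne _ _ _ (rGH_ne h .A2Q (fun _ e => HReg.noConfusion e)), hBase_A2Q]
/-- Writing `A2Q`. [folklore] -/
@[simp] theorem update_hSt_A2Q : Function.update (hSt h T u) (h .A2Q) v = hSt h T { u with a2q := v } := by
  rw [hSt, update_gSt_of_ne _ _ _ (rGH_ne h .A2Q (fun _ e => HReg.noConfusion e)), update_hBase_A2Q]; rfl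
/-- Reading `SFM`. [folklore] -/
@[simp] theorem hSt_SFM : hSt h T u (h .SFM) = u.sfm := by
  rw [hSt, gSt_of_ne _ _ _ (rGH_ne h .SFM (fun _ e => HReg.noConfusion e)), hBase_SFM]
/-- Writing `SFM`. [folklore] -/
@[simp] theorem update_hSt_SFM : Function.update (hSt h T u) (h .SFM) v = hSt h T { u with sfm := v } := by
  rw [hSt, update_gSt_of_ne _ _ _ (rGH_ne h .SFM (fun _ e => HReg.noConfusion e)), update_hBase_SFM]; rfl
/-- Reading `SFD`. [folklore] -/
@[simp] theorem hSt_SFD : hSt h T u (h .SFD) = u.sfd := by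
  rw [hSt, gSt_of_ne _ _ _ (rGH_ne h .SFD (fun _ e => HReg.noConfusion e)), hBase_SFD]
/-- Writing `SFD`. [folklore] -/
@[simp] theorem update_hSt_SFD : Function.update (hSt h T u) (h .SFD) v = hSt h T { u with sfd := v } := by
  rw [hSt, update_gSt_of_ne _ _ _ (rGH_ne h .SFD (fun _ e => HReg.noConfusion e)), update_hBase_SFD]; rfl
/-- Reading `SFB`. [folklore] -/
@[simp] theorem hSt_SFB : hSt h T u (h .SFB) = u.sfb := by
  rw [hSt, gSt_of_ne _ _ _ (rGH_ne h .SFB (fun _ e => HReg.noConfusion e)), hBase_SFB]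
/-- Writing `SFB`. [folklore] -/
@[simp] theorem update_hSt_SFB : Function.update (hSt h T u) (h .SFB) v = hSt h T { u with sfb := v } := by
  rw [hSt, update_gSt_of_ne _ _ _ (rGH_ne h .SFB (fun _ e => HReg.noConfusion e)), update_hBase_SFB]; rfl
/-- Reading `SFBMAX`. [folklore] -/
@[simp] theorem hSt_SFBMAX : hSt h T u (h .SFBMAX) = u.sfbmax := by
  rw [hSt, gSt_of_ne _ _ _ (rGH_ne h .SFBMAX (fun _ e => HReg.noConfusion e)), hBase_SFBMAX]
/-- Writing `SFBMAX`. [folklore] -/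
@[simp] theorem update_hSt_SFBMAX : Function.update (hSt h T u) (h .SFBMAX) v = hSt h T { u with sfbmax := v } := by
  rw [hSt, update_gSt_of_ne _ _ _ (rGH_ne h .SFBMAX (fun _ e => HReg.noConfusion e)), update_hBase_SFBMAX]; rfl
/-- Reading `SFL`. [folklore] -/
@[simp] theorem hSt_SFL : hSt h T u (h .SFL) = u.sfl := by
  rw [hSt, gSt_of_ne _ _ _ (rGH_ne h .SFL (fun _ e => HReg.noConfusion e)), hBase_SFL]
/-- Writing `SFL`. [folklore] -/
@[simp] theorem update_hSt_SFL : Function.update (hSt h T u) (h .SFL) v = hSt h T { u with sfl := v } := by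
  rw [hSt, update_gSt_of_ne _ _ _ (rGH_ne h .SFL (fun _ e => HReg.noConfusion e)), update_hBase_SFL]; rfl
/-- Reading `SFK`. [folklore] -/
@[simp] theorem hSt_SFK : hSt h T u (h .SFK) = u.sfk := by
  rw [hSt, gSt_of_ne _ _ _ (rGH_ne h .SFK (fun _ e => HReg.noConfusion e)), hBase_SFK]
/-- Writing `SFK`. [folklore] -/
@[simp] theorem update_hSt_SFK : Function.update (hSt h T u) (h .SFK) v = hSt h T { u with sfk := v } := by
  rw [hSt, update_gSt_of_ne _ _ _ (rGH_ne h .SFK (fun _ e => HReg.noConfusion e)), update_hBase_SFK]; rfl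
/-- Reading `SFDIVS`. [folklore] -/
@[simp] theorem hSt_SFDIVS : hSt h T u (h .SFDIVS) = u.sfdivs := by
  rw [hSt, gSt_of_ne _ _ _ (rGH_ne h .SFDIVS (fun _ e => HReg.noConfusion e)), hBase_SFDIVS]
/-- Writing `SFDIVS`. [folklore] -/
@[simp] theorem update_hSt_SFDIVS : Function.update (hSt h T u) (h .SFDIVS) v = hSt h T { u with sfdivs := v } := by
  rw [hSt, update_gSt_of_ne _ _ _ (rGH_ne h .SFDIVS (fun _ e => HReg.noConfusion e)), update_hBase_SFDIVS]; rfl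
/-- Reading `SFT`. [folklore] -/
@[simp] theorem hSt_SFT : hSt h T u (h .SFT) = u.sft := by
  rw [hSt, gSt_of_ne _ _ _ (rGH_ne h .SFT (fun _ e => HReg.noConfusion e)), hBase_SFT]
/-- Writing `SFT`. [folklore] -/
@[simp] theorem update_hSt_SFT : Function.update (hSt h T u) (h .SFT) v = hSt h T { u with sft := v } := by
  rw [hSt, update_gSt_of_ne _ _ _ (rGH_ne h .SFT (fun _ e => HReg.noConfusion e)), update_hBase_SFT]; rfl
/-- Reading `SFCAND`. [folklore] -/
@[simp] theorem hSt_SFCAND : hSt h T u (h .SFCAND) = u.sfcand := by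
  rw [hSt, gSt_of_ne _ _ _ (rGH_ne h .SFCAND (fun _ e => HReg.noConfusion e)), hBase_SFCAND]
/-- Writing `SFCAND`. [folklore] -/
@[simp] theorem update_hSt_SFCAND : Function.update (hSt h T u) (h .SFCAND) v = hSt h T { u with sfcand := v } := by
  rw [hSt, update_gSt_of_ne _ _ _ (rGH_ne h .SFCAND (fun _ e => HReg.noConfusion e)), update_hBase_SFCAND]; rfl
/-- Reading `SFBETA`. [folklore] -/
@[simp] theorem hSt_SFBETA : hSt h T u (h .SFBETA) = u.sfbeta := by
  rw [hSt, gSt_of_ne _ _ _ (rGH_ne h .SFBETA (fun _ e => HReg.noConfusion e)), hBase_SFBETA]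
/-- Writing `SFBETA`. [folklore] -/
@[simp] theorem update_hSt_SFBETA : Function.update (hSt h T u) (h .SFBETA) v = hSt h T { u with sfbeta := v } := by
  rw [hSt, update_gSt_of_ne _ _ _ (rGH_ne h .SFBETA (fun _ e => HReg.noConfusion e)), update_hBase_SFBETA]; rfl
/-- Reading `SFE`. [folklore] -/
@[simp] theorem hSt_SFE : hSt h T u (h .SFE) = u.sfe := by
  rw [hSt, gSt_of_ne _ _ _ (rGH_ne h .SFE (fun _ e => HReg.noConfusion e)), hBase_SFE]
/-- Writing `SFE`. [folklore] -/
@[simp] theorem update_hSt_SFE : Function.update (hSt h T u) (h .SFE) v = hSt h T { u with sfe := v } := by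
  rw [hSt, update_gSt_of_ne _ _ _ (rGH_ne h .SFE (fun _ e => HReg.noConfusion e)), update_hBase_SFE]; rfl
/-- Reading `SFR`. [folklore] -/
@[simp] theorem hSt_SFR : hSt h T u (h .SFR) = u.sfr := by
  rw [hSt, gSt_of_ne _ _ _ (rGH_ne h .SFR (fun _ e => HReg.noConfusion e)), hBase_SFR]
/-- Writing `SFR`. [folklore] -/
@[simp] theorem update_hSt_SFR : Function.update (hSt h T u) (h .SFR) v = hSt h T { u with sfr := v } := by
  rw [hSt, update_gSt_of_ne _ _ _ (rGH_ne h .SFR (fun _ e => HReg.noConfusion e)), update_hBase_SFR]; rfl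
/-- Reading `MN0`. [folklore] -/
@[simp] theorem hSt_MN0 : hSt h T u (h .MN0) = u.mn0 := by
  rw [hSt, gSt_of_ne _ _ _ (rGH_ne h .MN0 (fun _ e => HReg.noConfusion e)), hBase_MN0]
/-- Writing `MN0`. [folklore] -/
@[simp] theorem update_hSt_MN0 : Function.update (hSt h T u) (h .MN0) v = hSt h T { u with mn0 := v } := by
  rw [hSt, update_gSt_of_ne _ _ _ (rGH_ne h .MN0 (fun _ e => HReg.noConfusion e)), update_hBase_MN0]; rfl
/-- Reading `MNC`. [folklore] -/
@[simp] theorem hSt_MNC : hSt h T u (h .MNC) = u.mnc := by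
  rw [hSt, gSt_of_ne _ _ _ (rGH_ne h .MNC (fun _ e => HReg.noConfusion e)), hBase_MNC]
/-- Writing `MNC`. [folklore] -/
@[simp] theorem update_hSt_MNC : Function.update (hSt h T u) (h .MNC) v = hSt h T { u with mnc := v } := by
  rw [hSt, update_gSt_of_ne _ _ _ (rGH_ne h .MNC (fun _ e => HReg.noConfusion e)), update_hBase_MNC]; rfl
/-- Reading `MNF`. [folklore] -/
@[simp] theorem hSt_MNF : hSt h T u (h .MNF) = u.mnf := by
  rw [hSt, gSt_of_ne _ _ _ (rGH_ne h .MNF (fun _ e => HReg.noConfusion e)), hBase_MNF]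
/-- Writing `MNF`. [folklore] -/
@[simp] theorem update_hSt_MNF : Function.update (hSt h T u) (h .MNF) v = hSt h T { u with mnf := v } := by
  rw [hSt, update_gSt_of_ne _ _ _ (rGH_ne h .MNF (fun _ e => HReg.noConfusion e)), update_hBase_MNF]; rfl
/-- Reading `MNP`. [folklore] -/
@[simp] theorem hSt_MNP : hSt h T u (h .MNP) = u.mnp := by
  rw [hSt, gSt_of_ne _ _ _ (rGH_ne h .MNP (fun _ e => HReg.noConfusion e)), hBase_MNP]
/-- Writing `MNP`. [folklore] -/
@[simp] theorem update_hSt_MNP : Function.update (hSt h T u) (h .MNP) v = hSt h T { u with mnp := v } := by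
  rw [hSt, update_gSt_of_ne _ _ _ (rGH_ne h .MNP (fun _ e => HReg.noConfusion e)), update_hBase_MNP]; rfl
/-- Reading `MNB`. [folklore] -/
@[simp] theorem hSt_MNB : hSt h T u (h .MNB) = u.mnb := by
  rw [hSt, gSt_of_ne _ _ _ (rGH_ne h .MNB (fun _ e => HReg.noConfusion e)), hBase_MNB]
/-- Writing `MNB`. [folklore] -/
@[simp] theorem update_hSt_MNB : Function.update (hSt h T u) (h .MNB) v = hSt h T { u with mnb := v } := by
  rw [hSt, update_gSt_of_ne _ _ _ (rGH_ne h .MNB (fun _ e => HReg.noConfusion e)), update_hBase_MNB]; rfl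
/-- Reading `MNI`. [folklore] -/
@[simp] theorem hSt_MNI : hSt h T u (h .MNI) = u.mni := by
  rw [hSt, gSt_of_ne _ _ _ (rGH_ne h .MNI (fun _ e => HReg.noConfusion e)), hBase_MNI]
/-- Writing `MNI`. [folklore] -/
@[simp] theorem update_hSt_MNI : Function.update (hSt h T u) (h .MNI) v = hSt h T { u with mni := v } := by
  rw [hSt, update_gSt_of_ne _ _ _ (rGH_ne h .MNI (fun _ e => HReg.noConfusion e)), update_hBase_MNI]; rfl
/-- Reading `INP`. [folklore] -/
@[simp] theorem hSt_INP : hSt h T u (h .INP) = u.inp := by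
  rw [hSt, gSt_of_ne _ _ _ (rGH_ne h .INP (fun _ e => HReg.noConfusion e)), hBase_INP]
/-- Writing `INP`. [folklore] -/
@[simp] theorem update_hSt_INP : Function.update (hSt h T u) (h .INP) v = hSt h T { u with inp := v } := by
  rw [hSt, update_gSt_of_ne _ _ _ (rGH_ne h .INP (fun _ e => HReg.noConfusion e)), update_hBase_INP]; rfl
/-- Reading `OUTP`. [folklore] -/
@[simp] theorem hSt_OUTP : hSt h T u (h .OUTP) = u.outp := by
  rw [hSt, gSt_of_ne _ _ _ (rGH_ne h .OUTP (fun _ e => HReg.noConfusion e)), hBase_OUTP]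
/-- Writing `OUTP`. [folklore] -/
@[simp] theorem update_hSt_OUTP : Function.update (hSt h T u) (h .OUTP) v = hSt h T { u with outp := v } := by
  rw [hSt, update_gSt_of_ne _ _ _ (rGH_ne h .OUTP (fun _ e => HReg.noConfusion e)), update_hBase_OUTP]; rfl
/-- Reading the multiplier's `BF`. [folklore] -/
@[simp] theorem hSt_gBF : hSt h T u (h (.g .BF)) = u.gw.bf := by
  rw [hSt, ← rGH_apply, gSt_BF]
/-- Writing the multiplier's `BF`. [folklore] -/
@[simp] theorem update_hSt_gBF : Function.update (hSt h T u) (h (.g .BF)) v = hSt h T { u with gw := { u.gw with bf := v } } := by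
  rw [hSt, ← rGH_apply, update_gSt_BF]; rfl
/-- Reading the multiplier's `BG`. [folklore] -/
@[simp] theorem hSt_gBG : hSt h T u (h (.g .BG)) = u.gw.bg := by
  rw [hSt, ← rGH_apply, gSt_BG]
/-- Writing the multiplier's `BG`. [folklore] -/
@[simp] theorem update_hSt_gBG : Function.update (hSt h T u) (h (.g .BG)) v = hSt h T { u with gw := { u.gw with bg := v } } := by
  rw [hSt, ← rGH_apply, update_gSt_BG]; rfl
/-- Reading the multiplier's `RR`. [folklore] -/
@[simp] theorem hSt_gRR : hSt h T u (h (.g .RR)) = u.gw.rr := by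
  rw [hSt, ← rGH_apply, gSt_RR]
/-- Writing the multiplier's `RR`. [folklore] -/
@[simp] theorem update_hSt_gRR : Function.update (hSt h T u) (h (.g .RR)) v = hSt h T { u with gw := { u.gw with rr := v } } := by
  rw [hSt, ← rGH_apply, update_gSt_RR]; rfl
/-- Reading the multiplier's `KN`. [folklore] -/
@[simp] theorem hSt_gKN : hSt h T u (h (.g .KN)) = u.gw.kn := by
  rw [hSt, ← rGH_apply, gSt_KN]
/-- Writing the multiplier's `KN`. [folklore] -/
@[simp] theorem update_hSt_gKN : Function.update (hSt h T u) (h (.g .KN)) v = hSt h T { u with gw := { u.gw with kn := v } } := by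
  rw [hSt, ← rGH_apply, update_gSt_KN]; rfl
/-- Reading the modulus register (an ambient constant below both layers). [folklore] -/
theorem hSt_gv {x : VReg} (h1 : x ≠ .LEN) (h2 : x ≠ .C) (h3 : x ≠ .E) (h4 : x ≠ .L1) (h5 : x ≠ .L2) (h6 : x ≠ .DST) :
    hSt h T u (h (.g (.f (.n (.v x))))) = T (h (.g (.f (.n (.v x))))) := by
  rw [hSt, ← rGH_apply, gSt_v _ _ _ h1 h2 h3 h4 h5 h6, rGH_apply, hBase_g]

/-- Reading the multiplier's constant `CINV` (ambient). [folklore] -/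
@[simp] theorem hSt_gCINV : hSt h T u (h (.g .CINV)) = T (h (.g .CINV)) := by
  rw [hSt, ← rGH_apply, gSt_CINV, rGH_apply, hBase_g]

end HStLemmas


end Com

end Literature.Computability.Complexity
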